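import Mathlib
import HarnessLib
import HarnessLib.Audit
import Summits.AtomisticToContinuum.Statement
import Summits.AtomisticToContinuum.HydrodynamicLimit.Theorems.ImplosionDichotomyHsEosLowDensity
import Summits.AtomisticToContinuum.HydrodynamicLimit.Theorems.HeatBathForgettingAssembly
import Summits.AtomisticToContinuum.HydrodynamicLimit.Theorems.OneFlightGossipEngineEnergyCurrentTailsSplitLagged
import HarnessLib.Audit.Status.Attr

/-!
Route: JaynesSqueeze

DORMANT since 2026-08-24T16:56:42Z (reconciler: no traction for 6.9 d (last activity item-evidence-added at 2026-08-17T18:25:28Z); parked, not closed — `ledger route dormant route-AtomisticToContinuum-JaynesSqueeze --off` to reactivate) — unstaffed, not closed; items shared with open routes are served there. `ledger route dormant <id> --off` reactivates.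

# Route JaynesSqueeze — one scalar (no thermodynamic entropy gain of the mean one-body profile) pins
block local Gibbsianity; contact locality + Dafermos close Euler; bookkeeping gives Yau's entropy
target

It suffices to show X = K1 ∧ K2 ∧ K4 ∧ R ∧ D, realising card jaynes-squeeze-isentropic (spine) in
its general-data form (conforming re-opening of the retired route OneBodyEntropySqueeze, whose
assembly concluded the Literature decl and had no deciding theorem). K1 NoMeanEntropyProduction: in
the dilute band, before the first shock, the BLOCK-AVERAGED MEAN one-body profile (ρ_B, u_B, θ_B)(s)
of the deterministically evolved local Gibbs law — block masses, momenta and kinetic temperatures of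
the one-body INTENSITY measure (N+1)⁻¹Σ_i law(z_i(s)) on macroscopic cubes of side 1/m, the ensemble
variance of the block velocity counting as heat — carries asymptotically no more hard-sphere
thermodynamic entropy Σ_B m_B s_σ(ρ_B,θ_B), s_σ = 3/2 log θ − log ρ − f_ex(ρσ³), than the classical
Euler solution (ONE scalar per time). K2 CollisionalFluxLocality: block local Gibbsianity in
specific relative entropy forces the time-integrated MEAN collisional momentum/energy transfer to be
the local collisional pressure ρθ(Z(ρσ³) − 1) of the block mean fields. K4 EnergyCurrentTails: cubic
velocity tails of the evolved law are uniformly integrable (shared item 9235). R MeanBlocksInRange: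
the mean block fields stay in a compact range (a priori, conjunct-strength, now ranked). D
DiluteSelfConsistency (shared 3091): admissible classical solutions stay in the dilute packing band,
so that the statics apply at the local density. Exact finite-N bookkeeping — Liouville invariance of
Shannon entropy + log-linearity of hard-sphere local Gibbs densities in the empirical fields — gives
H(f_s‖ψ_λ)/(N+1) = [Π_N(λ) − ⟨P̄_s,λ⟩] − [Π_N(λ₀) − ⟨P̄₀,λ₀⟩] for EVERY local Gibbs reference ψ_λ;
at the block-matched reference (Csiszár I-projection) the static local-density approximation turns
the right side into 𝒮[U₀] − 𝒮^m_N(s) + o(1), so K1 (+ the free Clausius direction 𝒮^m_N(s) ≥ 𝒮[U₀] −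
o(1)) is EQUIVALENT to block local Gibbsianity in specific relative entropy (typed waypoint
BlockGibbs, support item SqueezeToBlockGibbs — the squeeze proper); its one-body shadow is kinetic
local equilibrium of the intensity measure; K2 + K4 close the mean fluxes, Dafermos'
relative-entropy stability with only the GLOBAL entropy inequality (EntropicWeakStrongHS) pins the
block mean fields to the classical solution, and the same bookkeeping at the Euler-driven reference
yields the shared typed target RelEntropyVanishing (0766) (support item BlockGibbsToRelEntropy). The
whole derivation X ⟹ RelEntropyVanishing is the crux-grade item SqueezeClosure (rank 7, the only
non-dynamical crux; the supports are its lemmas), and the entropy-inequality transfer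
RelEntropyVanishing → HydrodynamicLimit is the PROVED shared statement 0769
(Theorems.heatBathForgetting_assembly_proof), invoked inside `closes`. The card's isentropic
NoExcessHeat (Δ^m_N(s) = Σ_B m_B(3/2 θ_B − 3/2 θ_ad(ρ_B))/θ_ad(ρ_B) ≤ δ: no heat above the data
adiabat = no anomalous dissipation of the barotropic energy) implies K1 for isentropic data by
concavity of log and is the MD-testable face of K1 (filed as support on tenure, see Two-layer plan).
Lean: `NoMeanEntropyProduction ∧ CollisionalFluxLocality ∧ EnergyCurrentTails ∧ MeanBlocksInRange ∧
DiluteSelfConsistency ∧ SqueezeClosure`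

## Assembly
Crux-only deciding theorem (DECISIONS 2026-08-16 'definition of a route'; installed by route-repair
2026-08-16, Sketch.lean rc 0, axioms propext / Classical.choice / Quot.sound): `theorem closes (h₁ :
NoMeanEntropyProduction) (h₂ : CollisionalFluxLocality) (h₃ : EnergyCurrentTails) (h₄ :
MeanBlocksInRange) (h₅ : DiluteSelfConsistency) (h₆ : SqueezeClosure) : _root_.HydrodynamicLimit :=
Theorems.heatBathForgetting_assembly_proof (h₆ h₁ h₂ h₃ h₄ h₅)` — six binders, all cruxes; the
transfer RelEntropyVanishing → HydrodynamicLimit (shared 0769, proved, dropped from this route's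
item list to respect the 15-item cap) enters as a proved lemma. SqueezeClosure (X ⟹
RelEntropyVanishing) is where the route's own analysis sits; it is the composite of the filed
supports — SqueezeToBlockGibbs (M: K1 + R + statics ⟹ BlockGibbs), BlockGibbsToRelEntropy (L:
BlockGibbs + K2 + K4 + R + Dafermos + statics ⟹ 0766; reduced by landed
Theorems/JaynesSqueezeBlockGibbsToRelEntropy{Reduction,Core} to the waypoint MeanFieldsConverge),
EntropicWeakStrongHS (L, known type), LocalGibbsConcentrationDilute (M, known type), HardSphereLDA
and HsEosLowDensity (PROVED) — by the pure-logic glue `fun hS hB hW hL h₁ h₂ h₃ h₄ h₅ => hB (hS h₁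
h₄ hLDA hEos h₅) h₂ h₃ h₄ hW hLDA hL hEos h₅`; those supports keep their statements and names
(landed Theorems/JaynesSqueeze*.lean reference them) and are proved as ordinary items. The Assembly
item below is the frame statement X → HydrodynamicLimit for the dynamical X = K1 ∧ K2 ∧ K4 ∧ R ∧ D
(= SqueezeClosure followed by the transfer; one line once SqueezeClosure is proved); it is not a
hypothesis of `closes`.

Rationale: WHY THIS LINE. Three finite-N facts about the conjunct's own objects — S(f_t) = S(f_0) for the
push-forward density (HardSphereFlow is Liouville-preserving; Jaynes1965), log-linearity of
hard-sphere local Gibbs densities in the empirical one-body fields (hard core = common support, no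
pair energy), and the chain rule of relative entropy with conditionally Maxwellian velocities — make
the relative entropy of the evolved law w.r.t. ANY local Gibbs reference an explicit functional of
the MEAN one-body fields; at the block-matched reference (the I-projection of Csiszar1975) and with
the static local-density approximation (Ruelle1969 §3.4, LebowitzPenrose1964,
PulvirentiTsagkarogiannis2012, JansenKunaTsagkarogiannis2023 — the canonical cluster expansion with
slowly varying activity that the tree now PROVES for the LLN, HardSphereEulerLLN) Yau's
local-equilibrium target (Yau1991; OllaVaradhanYau1993 Thm 1.1 WITH noise) becomes one scalar
inequality on mean fields, with no particle-level Gronwall, no ergodic decomposition and no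
Euler-driven reference; GoldsteinLebowitz2004 eq. (33)/(41) is the one-body hard-sphere entropy
functional whose monotonicity they conjecture and which the route controls for the MEAN marginal;
Kosygina2001 is the stochastic precedent. Imported areas: information geometry (I-projection /
Pythagoras), hyperbolic-PDE stability (Dafermos1979 with the global Clausius–Duhem inequality;
BrezinaFeireisl2018, BerthelinVasseur2005), equilibrium statistical mechanics of the inhomogeneous
dilute hard-sphere gas (LDA, exponential concentration). Versus the open routes: ExpTailStaging /
KineticWindows / StiffCollisionalRelaxation run Yau's method or a moment hierarchy FORWARD with a
flux closure along the true flow and a Gronwall; here the entropy method runs backwards from a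
conserved quantity and the dynamical inputs shrink to a scalar (K1), contact locality (K2), a tail
bound (K4) and an a-priori range (R). Versus the retired OneBodyEntropySqueeze (route review notes
on stmt-6997): a certified `closes` concluding `_root_.HydrodynamicLimit`; the fat Assembly split
into the typed waypoint BlockGibbs and the implication items SqueezeToBlockGibbs /
BlockGibbsToRelEntropy; MeanBlocksInRange ranked; every EOS-facing item ties (ρ,u,θ) to the data AND
carries a dilute packing guard discharged by DiluteSelfConsistency (negatives index 9168 was a
junk-EOS refutation of an untied, unguarded statement); statics with packing-only smallness,
dischargeable for the σ-dependent Euler-driven reference.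

RANKED CRUXES. #0 RelEntropyVanishing (target) — shared typed waypoint X_RE
(stmt-AtomisticToContinuum-0766, also ExpTailStaging's target), re-asked verbatim: ∀ profiles ∃ σ₀ ∀
σ<σ₀ ∀ classical hs-Euler solutions on [0,T) ∀ flows: laws are probability measures and, if the
fields converge at t = 0, then ∀ t<T ∃ activity a_t with localGibbsLaw σ a_t u_t θ_t a probability
measure whose fields concentrate exponentially around (ρ,ρu,E)(t) and klDiv(lawAt t ‖ it)/(N+1) → 0.
Produced inside BlockGibbsToRelEntropy with a_t = ρ_t e^(g_σ(ρ_t)). (why it might fail: In substance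
the conjunct (given the statics it is EQUIVALENT to convergence of the mean one-body fields, by the
bookkeeping identity); false past the first shock (Rankine–Hugoniot entropy makes klDiv/(N+1) → Δs >
0).) [Yau1991, OllaVaradhanYau1993, Spohn1991, KipnisLandim1999]
#2 NoMeanEntropyProduction (crux) — (card S1 in general-data form, dilute-guarded) for continuous
local-Gibbs profiles ∃ σ₀ ∃ ηc>0 ∀ σ<σ₀, every classical hs-Euler solution (ρ,u,θ) on [0,T), every
flow family, the conjunct's t = 0 LLN hypothesis and every t < T with packing ρ_sσ³ ≤ ηc on [0,t]: ∀
δ>0 ∃ m₀ ∀ m ≥ m₀, eventually in N, for all s ≤ t: 𝒮^m_N(s) := Σ_(cubes B of side 1/m) m_B · s_σ(m³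
m_B, θ_B) ≤ ∫ ρ_s s_σ(ρ_s, θ_s) dx + δ, where m_B, u_B, θ_B are mass, mean velocity and kinetic
temperature of the one-body INTENSITY measure (N+1)⁻¹ Σ_i law(z_i(s)) restricted to B × ℝ³ (in-block
velocity variance counts as heat) and s_σ(r,ϑ) = 3/2 log ϑ − log r − hsExcessFreeEnergy(rσ³). The
free converse 𝒮^m_N(s) ≥ 𝒮[U₀] − o(1) (Clausius: Liouville + max-ent + LDA) makes this 'no
thermodynamic entropy production of the mean block profile before the shock'; equivalent via the
bookkeeping identity to BlockGibbs; holds at s = 0; violated by the ideal gas (phase mixing).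
[difficulty: open-problem] (why it might fail: It is the conjunct's dissipative content in scalar
form: false iff hard spheres at fixed σ put O(1) thermodynamic entropy into the MEAN block profile
before T (O(1) effective viscosity/conductivity at Euler scaling, or no local equilibrium); free
streaming violates it by phase mixing.) [Spohn1991, OllaVaradhanYau1993, Jaynes1965,
GoldsteinLebowitz2004, Kosygina2001, Csiszar1975]
#3 CollisionalFluxLocality (crux) — (card S4, conditional form, dilute-guarded) for local-Gibbs data
∃ σ₀ ∃ ηc>0 ∀ σ<σ₀, any flows, t > 0 and smooth χ: ∀ ε>0 ∃ δ>0 ∃ m₀ ∀ m ≥ m₀: IF eventually in N,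
for all s ≤ t, the time-s law is within specific relative entropy δ of SOME block-constant local
Gibbs law at scale m AND the block mean densities have packing ≤ ηc, THEN eventually in N the
collisional momentum source E[F^j_χ(t)] − E[F^j_χ(0)] − ∫₀ᵗ E[(N+1)⁻¹ Σ_i (v_i·∇χ(x_i)) v_i^j] ds is
within ε of ∫₀ᵗ Σ_B p_c(ρ_B,θ_B) ∫_B ∂_jχ ds, p_c(ρ,θ) = ρθ(hsCompressibility(ρσ³) − 1), and the
collisional energy source E[E_χ(t)] − E[E_χ(0)] − ∫₀ᵗ E[(N+1)⁻¹ Σ_i (v_i·∇χ(x_i))|v_i|²/2] ds is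
within ε of ∫₀ᵗ Σ_B p_c(ρ_B,θ_B) u_B·∫_B ∇χ ds (block mean fields of the intensity measure). Kinetic
parts of the fluxes are NOT in this item; global equilibrium passes trivially. [difficulty: L] (why
it might fail: Specific relative entropy o(N) at fixed times does not control codimension-one
contact statistics: a persistent O(1) distortion of the pair density at contact costs o(N) entropy
yet changes the collisional pressure ρθ(Z−1) by an O(1) factor.) [Spohn1991, Resibois1978,
OllaVaradhanYau1993, Lanford1975, PulvirentiSimonella2016]
#4 EnergyCurrentTails (crux) — (card S3; shared typed crux stmt-AtomisticToContinuum-9235 of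
KineticWindows / ExpTailStaging, verbatim) under the conjunct's hypotheses, for t < T: ∀ ε>0 ∃ M ∃
N₀ ∀ N ≥ N₀ ∀ s ∈ [0,t]: E[(N+1)⁻¹ Σ_i |v_i(s)|³ 1(|v_i(s)| > M)] ≤ ε (lintegral form): uniform
integrability of the cubic velocity moment along the deterministic evolution — the only moment
beyond the conserved energy that the kinetic energy-flux closure needs. [difficulty: open-problem]
(why it might fail: Energy is conserved only globally: after ≍N^{1/3} collisions per unit time a
vanishing fraction of spheres could carry O(1) energy in the cubic tail; OllaVaradhanYau1993 removed
exactly this by modifying the kinetic energy, impossible for hard spheres.) [OllaVaradhanYau1993,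
NachtergaeleYau2003, Spohn1991, Cercignani1988]
#5 MeanBlocksInRange (crux) — (a-priori non-degeneracy of the MEAN block profile, dilute-guarded;
load-bearing: compact conjugate parameters for the uniform LDA and Dafermos' compact K) under the
conjunct's hypotheses, t < T and packing ρ_sσ³ ≤ ηc on [0,t]: ∃ m₀ ∀ m ≥ m₀, eventually in N, for
all s ≤ t and all cubes B of side 1/m: m³m_B ∈ [½ inf ρ, 2 sup ρ], θ_B ∈ [½ inf θ, 2 sup θ], |u_B| ≤
1 + sup|u| (inf/sup of the classical solution over [0,t] × 𝕋³; m₀ absorbs the in-block velocity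
variance). Implied by the conjunct (+ energy UI); now ranked so that it is staffed and refutable on
its own. [difficulty: open-problem] (why it might fail: Conjunct-strength a priori: fails iff the
MEAN block density leaves [ρmin/2, 2ρmax] (vacuum / over-compression) or the block kinetic
temperature leaves [θmin/2, 2θmax] before T, i.e. iff hydrodynamics itself fails; no dynamical bound
on mean fields is known.) [Spohn1991, OllaVaradhanYau1993, Dafermos1979]
#6 DiluteSelfConsistency (crux) — shared crux stmt-AtomisticToContinuum-3091 (open; also wanted by
StiffCollisionalRelaxation), re-asked verbatim: ∀ η > 0 ∀ continuous positive profiles ∃ σ₀: for σ <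
σ₀ every classical hs-Euler solution on [0,T) whose t = 0 fields are the LLN limit of the local
Gibbs laws has packing ρ_t(x)σ³ < η on [0,T) × 𝕋³. Discharges every packing guard here; the statics'
smallness conditions are packing-only, hence dischargeable. [difficulty: open-problem] (why it might
fail: DenseExcursion (γ=5/3 smooth implosion tracked by the σ-family; MerleEtAl2022,
BuckmasterCaolaboraGomezserrano2025 on 𝕋³) would refute it; even if true it is a σ-uniform density
bound at the FIRST singularity of 3-D Euler for all smooth profiles.) [Sideris1985, LukSpeck2024,
MerleEtAl2022, BuckmasterCaolaboraGomezserrano2025, CaolaboraEtAl2025, Spohn1991]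
#7 SqueezeClosure (crux, stmt-AtomisticToContinuum-16266; filed 2026-08-16 by route-repair so that
`closes` assumes cruxes only) — NoMeanEntropyProduction → CollisionalFluxLocality →
EnergyCurrentTails → MeanBlocksInRange → DiluteSelfConsistency → RelEntropyVanishing: the derivation
X ⟹ Yau's target, composite of the support chain below by pure logic. Most tractable crux, hence
ranked last; state of the art: the bookkeeping at the Euler-driven reference is LANDED
(JaynesSqueezeClosure.relEntropyVanishing_of_klCore, klCore_of_meanFieldsConverge,
blockGibbsToRelEntropy_of_meanFieldsConverge; p112588), so what remains is the squeeze (13463, nine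
helper files landed) and MeanFieldsConverge from BlockGibbs + K2 + K4 + R + Dafermos. [difficulty:
L] (why it might fail: as ONE step it is L+ — uniform LDA over N-dependent block parameters;
mean-field convergence from o(N) block Gibbsianity with K2 typed at FIXED endpoints (N₀ = N₀(s))
while Dafermos' stability consumes a sup-in-s residual, prover memo v3 on stmt-13464.) [Yau1991,
OllaVaradhanYau1993, Dafermos1979, Csiszar1975, Jaynes1965, SaintRaymond2009]
SUPPORTS (rank 9; statements verbatim in the file; all are lemmas of SqueezeClosure, none is a
hypothesis of `closes`): HsEosLowDensity (shared 0768) — PROVED (Theorems.hsEosLowDensity_proof);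
HardSphereLDA (13459: inverse EOS for the data activity + LDA / probability / mean-density limit for
dilute measurable profiles) — PROVED (Theorems.hardSphereLDA_proof; its module imports this file, so
no `_holds` is rendered); LocalGibbsConcentrationDilute (13460: exponential LLN of the three
empirical fields under dilute local Gibbs laws, packing-only smallness; known type, M; eleven helper
files landed); EntropicWeakStrongHS (13461: Dafermos stability for hs-Euler in a-priori form with
only the global entropy inequality; known type, L; twelve helper files landed; NB the tree's
dafermos_weak_strong_stability was refuted as misstated — this item is typed independently);
BlockGibbs (13462: the typed waypoint — block local Gibbsianity in specific relative entropy with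
parameters in a compact range = hypothesis LG of K2; conjunct-strength, produced by the squeeze,
never attacked directly); SqueezeToBlockGibbs (13463: K1 → R → HardSphereLDA → HsEosLowDensity → D →
BlockGibbs, the squeeze proper: exact finite-N bookkeeping, conjugate block parameters + uniform LDA
+ Fenchel, t = 0 identification, K1 + classical entropy conservation; M); BlockGibbsToRelEntropy
(13464: BlockGibbs → K2 → K4 → R → EntropicWeakStrongHS → HardSphereLDA →
LocalGibbsConcentrationDilute → HsEosLowDensity → D → RelEntropyVanishing, the closure: kinetic
closure from block Gibbsianity, contact parts from K2, free Clausius direction, Dafermos,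
bookkeeping at the Euler-driven reference; L; REDUCED by the landed Core/Reduction files to the
waypoint MeanFieldsConverge — the prover's memo v3 grades the remaining production of
MeanFieldsConverge L+ and recommends filing it as its own item, see TWO-LAYER PLAN). The transfer
RelEntropyVanishing → HydrodynamicLimit (shared 0769, PROVED) was dropped from this route's item
list on 2026-08-16 (15-item cap) and is invoked inside `closes` as
Theorems.heatBathForgetting_assembly_proof.

TWO-LAYER PLAN. Foreseen glued splits (k ≤ 3, depth 1). FIRST, of SqueezeClosure (typed by
prover-pitem-13464 in evidence Restatement.lean on stmt-13464, elaborating against the route file):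
SqueezeClosure ⇐ SqueezeStep (K1 → R → D → BlockGibbs; = 13463 with the proved statics discharged) +
MeanFieldsFromBlockGibbs (BlockGibbs → K2 → K4 → R → EntropicWeakStrongHS → D → MeanFieldsConverge,
MeanFieldsConverge := the MEAN empirical density / momentum / energy fields of Φ_t z tested against
continuous χ converge to the Euler fields at every t < T — hypothesis hMFC of
JaynesSqueezeClosure.klCore_of_meanFieldsConverge verbatim; L+) with glue SqueezeStep →
MeanFieldsFromBlockGibbs → EntropicWeakStrongHS → LocalGibbsConcentrationDilute → SqueezeClosure
PROVABLE NOW from the landed relEntropyVanishing_of_klCore ∘ klCore_of_meanFieldsConverge; inside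
MeanFieldsFromBlockGibbs the prover's recommended cut is KineticClosure (conditional, M–L, provable
now) + BlockEntropyClausius / ClausiusFromStatics (free Clausius direction, M, shares 13463 step
(ii)) + MeanFieldsFromDafermos (L) — and EITHER a time-mollified Dafermos comparison field OR
CollisionalFluxLocality restated uniformly in the endpoint (the ∀ s ≤ t inside ∀ᶠ N; same physics,
same kill criterion; ≈7 kLoC instead of ≈9) — a tenure decision, not taken by the repair seat. THEN:
NoMeanEntropyProduction ⇐ FluxWorkBudget (∫₀ᵗ∫(Π̄ − p𝟙):∇ū ≥ −o(1)) → EntropyBalanceOfMeanProfile →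
NoMeanEntropyProduction, with the card's isentropic special case NoExcessHeatIsentropic (old decl
7004) as support; CollisionalFluxLocality ⇐ ContactShellEquilibration → StaticVirialIdentity →
CollisionalFluxLocality. Top level is at the 15-item cap: new statements enter only below an item
(`--split`).

KILL CRITERIA. ¬NoMeanEntropyProduction at some fixed small σ (a theorem, or MD showing an
N-independent plateau of 𝒮^m_N(t) − 𝒮[U(t)] before the shock) closes the route
`refuted:NoMeanEntropyProduction` and — K1 being implied by the conjunct given the statics and
energy UI — is summit-level negative evidence. ¬CollisionalFluxLocality (contact correlations
persisting under block Gibbsianity along the true flow) kills only the EOS identification: pivot by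
restating K2 with an explicit contact-equilibration hypothesis or close
`refuted:CollisionalFluxLocality` if the witness is dynamical. ¬EnergyCurrentTails (energy cascade
into the cubic tail) refutes the energy-flux closure here and in KineticWindows / ExpTailStaging
alike: close. ¬MeanBlocksInRange as TYPED (normalisation slip) is a restate; a dynamical witness is
negative evidence like ¬K1. DiluteSelfConsistency refuted (DenseExcursion proved) BREAKS this route
together with StiffCollisionalRelaxation and every σ₀-from-cluster-expansion plan: no repair inside
the Statement as typed; close `refuted:DiluteSelfConsistency`. ¬SqueezeClosure can only come through
¬(one of its supports as typed): a typing-level refutation of SqueezeToBlockGibbs /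
BlockGibbsToRelEntropy / a static item (junk branch, measurability, quantifier order) is a restate
of that support (SqueezeClosure itself only names the five cruxes and the target), a dynamical
witness would be ¬K1-type summit-level evidence. RelEntropyVanishing proved elsewhere moots
SqueezeClosure and the two implication items; a refutation of a static item as typed (junk branch,
measurability) is a restate, not a kill.

NOT DECOMPOSED YET. The waypoint MeanFieldsConverge and the four sub-statements of the prover's
re-plan (KineticClosure, ClausiusFromStatics, MeanFieldsFromDafermos, CollisionalFluxLocalityUniform
— evidence Restatement.lean / MeanFieldsConverge-memo.md v3 on stmt-13464) are typed but not filed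
(cap; see TWO-LAYER PLAN). The bookkeeping identity, the Gaussian velocity integrals and the KL
chain rule for block velocity laws (old decl OneBodyShadow, provable now) ride with `--supports
SqueezeToBlockGibbs` / `--supports BlockGibbsToRelEntropy`, not as items; uniformity of the LDA over
compact block-constant families; joint (s,z)-measurability of the flow and interval-integrability
for the time integrals in K2 (prover hazard recorded by the route review); entropy and mass
conservation for classical solutions in TorusCalculus; restriction of IsHardSphereEulerSolution to
[0,T′]; the equicontinuity-in-s lemma for mean block fields (needed only for the converse 'K1 ⟸
conjunct'); any rate in N (Kn^(1/2) expected); tent / heat-kernel mollifiers deliberately NOT used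
(their commutator with the exponential family does not vanish); d = 3 only; post-shock statements
left to sibling cards.

CHEAPEST FALSIFIER. (i) Paper check, done (card + route review): free streaming (the
BoltzmannHypothesis kernel) satisfies every identity of the route and VIOLATES K1 — a sheared local
Maxwellian phase-mixes, the block kinetic temperature of the intensity measure grows ∝ t²|∇u|² — so
K1 is interaction-sensitive, not a tautology; global equilibrium (boosted or not) satisfies K1, K2,
R trivially. (ii) Event-driven MD at packing 0.05, decaying shear wave and simple sound wave, N =
10⁴…10⁶ (kit): 𝒮^m_N(t) − 𝒮[U(t)] (and Δ^m_N(t) for isentropic data) is measurable from cell means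
and must DEcrease like Kn ∝ N^(-1/3); an N-independent positive plateau before the shock kills K1;
the same runs test K2 (cell collisional virial vs ρ_Bθ_B(Z − 1)), K4 (cubic tail mass) and R (cell
ranges). (iii) Symbol-level junk audit of the guarded items (done: empty blocks contribute 0,
ent(0,0) = 0, idx ∈ range, every EOS evaluation at packing ≤ ηc < 512).

NUMBERS. (N+1)ε³ = σ³ fixed; Kn ≍ (N+1)^(-1/3). EOS: Z(η) = 1 + (2π/3)η + O(η²) (η = ρσ³, φ = πη/6),
p_c/p_kin = Z − 1 ≈ 2.09 η; Carnahan–Starling excess entropy per particle ≈ 4φ = slack of the crude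
squeeze without the hard-core term (closure only up to O(σ³) without HardSphereLDA); freezing at φ ≈
0.494; junk branch of the typed EOS (hsFreeVolume = 0) from η ≥ 512 (negatives 9168) — guarded items
sit at η ≤ ηc. Expected pre-shock K1 defect 𝒮^m_N(t) − 𝒮[U(t)] ≈ Kn·∫₀ᵗ∫(η_*|∇u|² + κ_*|∇θ|²/θ)/θ =
O(N^(-1/3)); past a shock it tends to the Rankine–Hugoniot production Δs(t) > 0 and klDiv/(N+1) →
Δs. Items: 15 at open (1 target, 5 cruxes, 8 supports, 1 assembly; `closes` used 12); since
2026-08-16 (route-repair, revs 6–9): 15 = 1 target 0766 + 6 cruxes (K1 13437, K2 13457, K4 9235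
shared, R 13458, D 3091 shared, SqueezeClosure 16266) + 7 supports (0768 shared proved, 13459
proved, 13460, 13461, 13462, 13463, 13464) + 1 assembly (15956); 0769 dropped as an item (proved,
used inside `closes`); `closes` uses the 6 cruxes only.

DEFINITION REQUESTS. None required: the one-body intensity measure, the cube partition (Torus.repr +
Nat.floor) and s_σ are inlined with `let`; optional conveniences `oneBodyIntensity`, `blockIndex m`,
`hsEntropyPerParticle σ` (topic Summits/AtomisticToContinuum/HydrodynamicLimit/Theorems). No cite
facts: the statics are support items, so the import cone has no unproved Literature fact; the tree's
proved localGibbs_lln / isProbabilityMeasure_localGibbsLaw are used inside the implication items.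

Novelty: Searches (2026-08-15, this seat; searchd local index rc 75, OpenAlex daily budget exhausted —
logged): `lit search --source crossref "Boltzmann entropy subadditivity one-particle marginal
hydrodynamic limit hard spheres"` (8 rows, Boltzmann–Grad correlation papers, none on Euler scaling:
doi:10.1063/1.4998194, doi:10.1007/bf01019139); `lit search --source crossref "Gibbs versus
Boltzmann entropies local equilibrium maximum entropy dense fluid Enskog H theorem"` (8:
doi:10.1103/physrevlett.92.050602 Garrido–Goldstein–Lebowitz 2004, doi:10.1103/physreva.29.926
Mareschal 1984 local entropy production for the revised Enskog equation, doi:10.1007/bfb0091358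
Bellomo–Lachowicz Enskog H-theorem); `lit search --source zbmath "relative entropy hydrodynamic
limit Euler equations local Gibbs deterministic"` (0); `lit search --source arxiv "hydrodynamic
limit compressible Euler relative entropy deterministic particle system local equilibrium"` (0);
`lit galaxy search "Gibbs vs Boltzmann entropies" --star all` (16 rows; relevant: pdf
arXiv:1506.02625 Kuić, predictive statistical mechanics / max-ent hydrodynamics and entropy
production — Jaynesian, formal, no limit theorem); `lit galaxy search "relative entropy method
hydrodynamic limit local Gibbs" --star all` (0) and `"hydrodynamic limit for a Hamiltonian system"
--star all` (0); `lit frontier AtomisticToContinuum --since 2022` (30 rows; nearest: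
doi:10.1007/s00222-026-01429-1 = arXiv:2310.13338 'Heat equation from a deterministic dynamic  [refs: 10.1063/1.4998194, 10.1007/bf01019139, 10.1103/physrevlett.92.050602, 10.1103/physreva.29.926, 10.1007/bfb0091358, 10.1007/s00222-026-01429-1, 10.1103/PhysRevA.4.747, 1506.02625, 2310.13338, doi:10.1063/1.4998194, doi:10.1007/bf01019139, doi:10.1103/physrevlett.92.050602, doi:10.1103/physreva.29.926, doi:10.1007/bfb0091358, doi:10.1007/s00222-026-01429-1, doi:10.1103/PhysRevA.4.747, Jaynes1965, Go]

Barriers (technique_class: relative-entropy max-ent one-body-entropy weak-strong): - technique_class: relative-entropy max-ent one-body-entropy weak-strong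
- Literature.Barriers.AtomisticToContinuum.BoltzmannHypothesisBarrier: met and respected, not evaded
by decree: the ideal gas (its kernel) satisfies every identity of the route and VIOLATES
NoMeanEntropyProduction (phase mixing raises the block kinetic temperature of the intensity
measure), so K1 is interaction-sensitive; pre-collisional factorisation AT CONTACT re-enters exactly
in CollisionalFluxLocality — conceded as a ranked crux, with the dynamics entering only through a
time-integrated mean contact functional.
- Literature.Barriers.AtomisticToContinuum.BoltzmannHypothesisBarrierNarrow: the flux-level kernel
(distinct stationary ideal-gas states with equal mass/momentum/energy moments) is exactly why the
route never infers the velocity law from conserved moments: Maxwellianity of the block velocity laws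
is DERIVED from K1 through the squeeze (entropy pinned at its maximum given the block moments forces
the max-ent law), and the kernel's states violate K1.
- Literature.Barriers.AtomisticToContinuum.HighMomentumCutoffBarrier: applies to the energy flux
only; isolated as the ranked crux EnergyCurrentTails (shared 9235); no other step needs a moment
beyond the conserved energy.
- Literature.Barriers.AtomisticToContinuum.HighMomentumCutoffBarrierNarrow: applies squarely
(entropy control against Maxwellian references cannot reach the cubic energy current): NOT evaded by
the entropy inequality — the route

History (route lifecycle, newest last):
- 2026-08-16T16:57:07Z · rev 3: restated Assembly (stmt-AtomisticToContinuum-13465 proved) — route-repair (ground-failed, unit rground-AtomisticToContinuum-JaynesSque-6bd5086b): Assembly (stmt-13465) was flagged ground.trivial (intros; aesop) because it (planner-rground-AtomisticToContinuum-JaynesSque-6bd5086b-0)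
- 2026-08-16T17:21:42Z · rev 7: dropped EntropyToHydro — route-repair (glue.non-crux-hypothesis; unit rbadge-AtomisticToContinuum-JaynesSque-6bd5086b) step 2a/3: drop the EntropyToHydro item from THIS route (shared st (planner-rbadge-AtomisticToContinuum-JaynesSque-6bd5086b-0)
- 2026-08-24T16:56:42Z · DORMANT — reconciler: no traction for 6.9 d (last activity item-evidence-added at 2026-08-17T18:25:28Z); parked, not closed — `ledger route dormant route-AtomisticToConti (operator:999:1470332)

sub-problem: HydrodynamicLimit · status: dormant · opened planner-plancard-AtomisticToContinuum-Hydrody-b6cd9e67-g2-0 2026-08-15T19:15:59Z · rev 11 · ledger route-AtomisticToContinuum-JaynesSqueeze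
GENERATED by the gate from the ledger (D-0016/17). Provers cite these decls: `theorem foo : Summit.AtomisticToContinuum.HydrodynamicLimit.Theses.JaynesSqueeze.<Decl> := …` in Summits/AtomisticToContinuum/HydrodynamicLimit/Theorems/<Name>.lean.
-/

namespace Summit.AtomisticToContinuum.HydrodynamicLimit.Theses.JaynesSqueeze

open scoped BigOperators Topology Manifold Classical MeasureTheory ProbabilityTheory Matrix InnerProductSpace ComplexConjugate ContinuousMap
open Filter Set Function TopologicalSpace MeasureTheory

attribute [summit_statement] _root_.HydrodynamicLimit

/-- item stmt-AtomisticToContinuum-0766 · target · rank 0 · open · by planner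
why it might fail: In substance the conjunct (given the statics it is EQUIVALENT to convergence of the mean one-body fields, by the bookkeeping identity); false past the first shock (Rankine–Hugoniot entropy makes klDiv/(N+1) → Δs > 0).
sources: Yau1991, OllaVaradhanYau1993, Spohn1991, KipnisLandim1999
[target] X_RE: for all continuous profiles ∃ σ₀ ∀ σ<σ₀ ∀ classical hs-Euler solutions on [0,T) ∀
flows: the initial local Gibbs laws are probability measures and, if their fields converge at t=0,
then ∀ t<T ∃ activity profile a_t such that the reference local Gibbs law (a_t, u_t, θ_t) is a
probability measure whose empirical density/momentum/energy fields concentrate exponentially (≤ C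
e^{-(N+1)/C}) around (ρ,ρu,E)(t), and klDiv(lawAt Φ_N (localGibbs a₀u₀θ₀) t ‖ localGibbs a_t u_t
θ_t)/(N+1) → 0. Yau1991; OllaVaradhanYau1993 Thm 1.1 (with noise). -/
@[route_item "route-AtomisticToContinuum-JaynesSqueeze"]
def RelEntropyVanishing : Prop :=
  ∀ (a₀ θ₀ : Literature.MathematicalPhysics.KineticTheory.T3 → ℝ) (u₀ : Literature.MathematicalPhysics.KineticTheory.T3 → Literature.MathematicalPhysics.KineticTheory.V3), Continuous a₀ → Continuous θ₀ → Continuous u₀ → (∀ x, 0 < a₀ x) → (∀ x, 0 < θ₀ x) → ∃ σ₀ : ℝ, 0 < σ₀ ∧ ∀ σ : ℝ, 0 < σ → σ < σ₀ → ∀ (T : ℝ) (ρ θ : ℝ → Literature.MathematicalPhysics.KineticTheory.T3 → ℝ) (u : ℝ → Literature.MathematicalPhysics.KineticTheory.T3 → Literature.MathematicalPhysics.KineticTheory.V3), Literature.MathematicalPhysics.KineticTheory.IsHardSphereEulerSolution σ T ρ u θ → ∀ Φ : (N : ℕ) → Literature.Analysis.FluidPDE.HardSphereFlow (Literature.Analysis.FluidPDE.Torus.geometry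 (Fin 3)) (Literature.MathematicalPhysics.KineticTheory.hsDiameter σ N) (N + 1), (∀ N, MeasureTheory.IsProbabilityMeasure (Literature.MathematicalPhysics.KineticTheory.localGibbsLaw σ a₀ u₀ θ₀ N (Φ N))) ∧ (Literature.MathematicalPhysics.KineticTheory.TendstoHydroFieldsAt (fun N => Literature.MathematicalPhysics.KineticTheory.localGibbsLaw σ a₀ u₀ θ₀ N (Φ N)) Φ ρ u θ 0 → ∀ t ∈ Set.Ico 0 T, ∃ a : Literature.MathematicalPhysics.KineticTheory.T3 → ℝ, (∀ N, MeasureTheory.IsProbabilityMeasure (Literature.MathematicalPhysics.KineticTheory.localGibbsLaw σ a (u t) (θ t) N (Φ N))) ∧ (∀ χ : Literature.MathematicalPhysics.KineticTheory.T3 → ℝ, Continuous χ → ∀ δ : ℝ, 0 < δ → ∃ C : ℝ, 0 < C ∧ ∀ N : ℕ, Literature.MathematicalPhysics.KineticTheory.localGibbsLaw σ a (u t) (θ t) N (Φ N) {z | δ < |Literature.MathematicalPhysics.KineticTheory.empiricalDensityField z χ - ∫ x, χ x * ρ t x|} ≤ ENNReal.ofReal (C * Real.exp (-(C⁻¹ *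 (N + 1)))) ∧ Literature.MathematicalPhysics.KineticTheory.localGibbsLaw σ a (u t) (θ t) N (Φ N) {z | δ < ‖Literature.MathematicalPhysics.KineticTheory.empiricalMomentumField z χ - ∫ x, (χ x * ρ t x) • u t x‖} ≤ ENNReal.ofReal (C * Real.exp (-(C⁻¹ * (N + 1)))) ∧ Literature.MathematicalPhysics.KineticTheory.localGibbsLaw σ a (u t) (θ t) N (Φ N) {z | δ < |Literature.MathematicalPhysics.KineticTheory.empiricalEnergyField z χ - ∫ x, χ x * Literature.MathematicalPhysics.KineticTheory.totalEnergyDensity (ρ t x) (u t x) (θ t x)|} ≤ ENNReal.ofReal (C * Real.exp (-(C⁻¹ * (N + 1))))) ∧ Filter.Tendsto (fun N : ℕ => InformationTheory.klDiv ((Φ N).lawAt (Literature.MathematicalPhysics.KineticTheory.localGibbsLaw σ a₀ u₀ θ₀ N (Φ N)) t) (Literature.MathematicalPhysics.KineticTheory.localGibbsLaw σ a (u t) (θ t) N (Φ N)) / ((N : ENNReal) + 1)) Filter.atTop (nhds 0))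

/-- item stmt-AtomisticToContinuum-13437 · crux · rank 2 · open · by planner
why it might fail: It is the conjunct's dissipative content in scalar form: false iff hard spheres at fixed σ put O(1) thermodynamic entropy into the MEAN block profile before T (O(1) effective viscosity/conductivity at Euler scaling, or no local equilibrium); free streaming violates it by phase mixing.
sources: Spohn1991, OllaVaradhanYau1993, Jaynes1965, GoldsteinLebowitz2004, Kosygina2001, Csiszar1975
[crux] (card S1 in general-data form, dilute-guarded) for continuous local-Gibbs profiles ∃ σ₀ ∃
ηc>0 ∀ σ<σ₀, every classical hs-Euler solution (ρ,u,θ) on [0,T), every flow family, the conjunct's t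
= 0 LLN hypothesis and every t < T with packing ρ_sσ³ ≤ ηc on [0,t]: ∀ δ>0 ∃ m₀ ∀ m ≥ m₀, eventually
in N, for all s ≤ t: 𝒮^m_N(s) := Σ_(cubes B of side 1/m) m_B · s_σ(m³ m_B, θ_B) ≤ ∫ ρ_s s_σ(ρ_s,
θ_s) dx + δ, where m_B, u_B, θ_B are mass, mean velocity and kinetic temperature of the one-body
INTENSITY measure (N+1)⁻¹ Σ_i law(z_i(s)) restricted to B × ℝ³ (in-block velocity variance counts as
heat) and s_σ(r,ϑ) = 3/2 log ϑ − log r − hsExcessFreeEnergy(rσ³). The free converse 𝒮^m_N(s) ≥ 𝒮[U₀]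
− o(1) (Clausius: Liouville + max-ent + LDA) makes this 'no thermodynamic entropy production of the
mean block profile before the shock'; equivalent via the bookkeeping identity to BlockGibbs; holds
at s = 0; violated by the ideal gas (phase mixing). [difficulty: open-problem] -/
@[route_item "route-AtomisticToContinuum-JaynesSqueeze", crux]
def NoMeanEntropyProduction : Prop :=
  ∀ (a₀ θ₀ : (UnitAddTorus (Fin 3)) → ℝ) (u₀ : (UnitAddTorus (Fin 3)) → (EuclideanSpace ℝ (Fin 3))), Continuous a₀ → Continuous θ₀ → Continuous u₀ → (∀ x, 0 < a₀ x) → (∀ x, 0 < θ₀ x) → ∃ σ₀ : ℝ, 0 < σ₀ ∧ ∃ ηc : ℝ, 0 < ηc ∧ ∀ σ : ℝ, 0 < σ → σ < σ₀ → ∀ (T : ℝ) (ρ θ : ℝ → (UnitAddTorus (Fin 3)) → ℝ) (u : ℝ → (UnitAddTorus (Fin 3)) → (EuclideanSpace ℝ (Fin 3))), Literature.MathematicalPhysics.KineticTheory.IsHardSphereEulerSolution σ T ρ u θ → ∀ Φ : (N : ℕ) → Literature.Analysis.FluidPDE.HardSphereFlow (Literature.Analysis.FluidPDE.Torus.geometry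 (Fin 3)) (Literature.MathematicalPhysics.KineticTheory.hsDiameter σ N) (N + 1), Literature.MathematicalPhysics.KineticTheory.TendstoHydroFieldsAt (fun N => Literature.MathematicalPhysics.KineticTheory.localGibbsLaw σ a₀ u₀ θ₀ N (Φ N)) Φ ρ u θ 0 → ∀ t ∈ Set.Ico 0 T, (∀ s ∈ Set.Icc 0 t, ∀ x, ρ s x * σ ^ 3 ≤ ηc) → let P : (N : ℕ) → MeasureTheory.Measure (Literature.Analysis.FluidPDE.Config (N + 1) (Fin 3) (UnitAddTorus (Fin 3))) := fun N => Literature.MathematicalPhysics.KineticTheory.localGibbsLaw σ a₀ u₀ θ₀ N (Φ N); let μ : (N : ℕ) → ℝ → MeasureTheory.Measure ((UnitAddTorus (Fin 3)) × (EuclideanSpace ℝ (Fin 3))) := fun N s => ((N : ENNReal) + 1)⁻¹ • MeasureTheory.Measure.sum (fun i : Fin (N + 1) => ((Φ N).lawAt (P N) s).map (fun z => z i)); let idx : ℕ → (UnitAddTorus (Fin 3)) → (Fin 3 → ℕ) := fun m x i => ⌊(m : ℝ) * Literature.Analysis.FunctionSpaces.Torus.repr x i⌋₊; let μB : ℕ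 → ℝ → ℕ → (Fin 3 → ℕ) → MeasureTheory.Measure (EuclideanSpace ℝ (Fin 3)) := fun N s m k => ((μ N s).restrict ({x : (UnitAddTorus (Fin 3)) | idx m x = k} ×ˢ (Set.univ : Set (EuclideanSpace ℝ (Fin 3))))).snd; let mass : ℕ → ℝ → ℕ → (Fin 3 → ℕ) → ℝ := fun N s m k => ((μB N s m k) Set.univ).toReal; let vel : ℕ → ℝ → ℕ → (Fin 3 → ℕ) → (EuclideanSpace ℝ (Fin 3)) := fun N s m k => (mass N s m k)⁻¹ • ∫ v, v ∂(μB N s m k); let temp : ℕ → ℝ → ℕ → (Fin 3 → ℕ) → ℝ := fun N s m k => (3 * mass N s m k)⁻¹ * ∫ v, ‖v - vel N s m k‖ ^ 2 ∂(μB N s m k); let ent : ℝ → ℝ → ℝ := fun r ϑ => 3 / 2 * Real.log ϑ - Real.log r - Literature.MathematicalPhysics.KineticTheory.hsExcessFreeEnergy (r * σ ^ 3); let Sblk : ℕ → ℝ → ℕ → ℝ := fun N s m => ∑ k ∈ Fintype.piFinset (fun _ : Fin 3 => Finset.range m), mass N s m k * ent ((m : ℝ) ^ 3 * mass N s m k)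 (temp N s m k); ∀ δ : ℝ, 0 < δ → ∃ m₀ : ℕ, ∀ m : ℕ, m₀ ≤ m → ∀ᶠ N : ℕ in Filter.atTop, ∀ s ∈ Set.Icc 0 t, Sblk N s m ≤ (∫ x, ρ s x * ent (ρ s x) (θ s x)) + δ

/-- item stmt-AtomisticToContinuum-13457 · crux · rank 3 · open · by planner
why it might fail: Specific relative entropy o(N) at fixed times does not control codimension-one contact statistics: a persistent O(1) distortion of the pair density at contact costs o(N) entropy yet changes the collisional pressure ρθ(Z−1) by an O(1) factor.
sources: Spohn1991, Resibois1978, OllaVaradhanYau1993, Lanford1975, PulvirentiSimonella2016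
[crux] (card S4, conditional form, dilute-guarded) for local-Gibbs data ∃ σ₀ ∃ ηc>0 ∀ σ<σ₀, any
flows, t > 0 and smooth χ: ∀ ε>0 ∃ δ>0 ∃ m₀ ∀ m ≥ m₀: IF eventually in N, for all s ≤ t, the time-s
law is within specific relative entropy δ of SOME block-constant local Gibbs law at scale m AND the
block mean densities have packing ≤ ηc, THEN eventually in N the collisional momentum source
E[F^j_χ(t)] − E[F^j_χ(0)] − ∫₀ᵗ E[(N+1)⁻¹ Σ_i (v_i·∇χ(x_i)) v_i^j] ds is within ε of ∫₀ᵗ Σ_B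
p_c(ρ_B,θ_B) ∫_B ∂_jχ ds, p_c(ρ,θ) = ρθ(hsCompressibility(ρσ³) − 1), and the collisional energy
source E[E_χ(t)] − E[E_χ(0)] − ∫₀ᵗ E[(N+1)⁻¹ Σ_i (v_i·∇χ(x_i))|v_i|²/2] ds is within ε of ∫₀ᵗ Σ_B
p_c(ρ_B,θ_B) u_B·∫_B ∇χ ds (block mean fields of the intensity measure). Kinetic parts of the fluxes
are NOT in this item; global equilibrium passes trivially. [difficulty: L] -/
@[route_item "route-AtomisticToContinuum-JaynesSqueeze", crux]
def CollisionalFluxLocality : Prop :=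
  ∀ (a₀ θ₀ : (UnitAddTorus (Fin 3)) → ℝ) (u₀ : (UnitAddTorus (Fin 3)) → (EuclideanSpace ℝ (Fin 3))), Continuous a₀ → Continuous θ₀ → Continuous u₀ → (∀ x, 0 < a₀ x) → (∀ x, 0 < θ₀ x) → ∃ σ₀ : ℝ, 0 < σ₀ ∧ ∃ ηc : ℝ, 0 < ηc ∧ ∀ σ : ℝ, 0 < σ → σ < σ₀ → ∀ Φ : (N : ℕ) → Literature.Analysis.FluidPDE.HardSphereFlow (Literature.Analysis.FluidPDE.Torus.geometry (Fin 3)) (Literature.MathematicalPhysics.KineticTheory.hsDiameter σ N) (N + 1), ∀ t : ℝ, 0 < t → ∀ χ : (UnitAddTorus (Fin 3)) → ℝ, Literature.Analysis.FunctionSpaces.Torus.IsSmooth χ → let P : (N : ℕ) → MeasureTheory.Measure (Literature.Analysis.FluidPDE.Config (N + 1) (Fin 3) (UnitAddTorus (Fin 3))) := fun N => Literature.MathematicalPhysics.KineticTheory.localGibbsLaw σ a₀ u₀ θ₀ N (Φ N); let μ : (N : ℕ) → ℝ → MeasureTheory.Measure ((UnitAddTorus (Fin 3)) × (EuclideanSpace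 ℝ (Fin 3))) := fun N s => ((N : ENNReal) + 1)⁻¹ • MeasureTheory.Measure.sum (fun i : Fin (N + 1) => ((Φ N).lawAt (P N) s).map (fun z => z i)); let idx : ℕ → (UnitAddTorus (Fin 3)) → (Fin 3 → ℕ) := fun m x i => ⌊(m : ℝ) * Literature.Analysis.FunctionSpaces.Torus.repr x i⌋₊; let μB : ℕ → ℝ → ℕ → (Fin 3 → ℕ) → MeasureTheory.Measure (EuclideanSpace ℝ (Fin 3)) := fun N s m k => ((μ N s).restrict ({x : (UnitAddTorus (Fin 3)) | idx m x = k} ×ˢ (Set.univ : Set (EuclideanSpace ℝ (Fin 3))))).snd; let mass : ℕ → ℝ → ℕ → (Fin 3 → ℕ) → ℝ := fun N s m k => ((μB N s m k) Set.univ).toReal; let vel : ℕ → ℝ → ℕ → (Fin 3 → ℕ) → (EuclideanSpace ℝ (Fin 3)) := fun N s m k => (mass N s m k)⁻¹ • ∫ v, v ∂(μB N s m k); let temp : ℕ → ℝ → ℕ → (Fin 3 → ℕ) → ℝ := fun N s m k => (3 * mass N s m k)⁻¹ * ∫ v, ‖v - vel N s m k‖ ^ 2 ∂(μB N s m k); let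 w : (UnitAddTorus (Fin 3)) × (EuclideanSpace ℝ (Fin 3)) → ℝ := fun y => ∑ l : Fin 3, y.2 l * Literature.Analysis.FunctionSpaces.Torus.partialDeriv l χ y.1; let gI : ℕ → (Fin 3 → ℕ) → Fin 3 → ℝ := fun m k j => ∫ x in {x : (UnitAddTorus (Fin 3)) | idx m x = k}, Literature.Analysis.FunctionSpaces.Torus.partialDeriv j χ x; let Emom : ℕ → ℝ → Fin 3 → ℝ := fun N s j => ∫ z, Literature.MathematicalPhysics.KineticTheory.empiricalMomentumField ((Φ N).flow s z) χ j ∂(P N); let Ekin : ℕ → ℝ → Fin 3 → ℝ := fun N s j => ∫ z, ((N : ℝ) + 1)⁻¹ * ∑ i : Fin (N + 1), w ((Φ N).flow s z i) * ((Φ N).flow s z i).2 j ∂(P N); let Rmom : ℕ → Fin 3 → ℝ := fun N j => Emom N t j - Emom N 0 j - ∫ s in (0 : ℝ)..t, Ekin N s j; let pc : ℝ → ℝ → ℝ := fun r ϑ => r * ϑ * (Literature.MathematicalPhysics.KineticTheory.hsCompressibility (r * σ ^ 3) - 1); let Cmom : ℕ → ℕ → Fin 3 → ℝ := fun N m j =>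 ∫ s in (0 : ℝ)..t, ∑ k ∈ Fintype.piFinset (fun _ : Fin 3 => Finset.range m), pc ((m : ℝ) ^ 3 * mass N s m k) (temp N s m k) * gI m k j; let Een : ℕ → ℝ → ℝ := fun N s => ∫ z, Literature.MathematicalPhysics.KineticTheory.empiricalEnergyField ((Φ N).flow s z) χ ∂(P N); let Ekin3 : ℕ → ℝ → ℝ := fun N s => ∫ z, ((N : ℝ) + 1)⁻¹ * ∑ i : Fin (N + 1), w ((Φ N).flow s z i) * (‖((Φ N).flow s z i).2‖ ^ 2 / 2) ∂(P N); let Ren : ℕ → ℝ := fun N => Een N t - Een N 0 - ∫ s in (0 : ℝ)..t, Ekin3 N s; let Cen : ℕ → ℕ → ℝ := fun N m => ∫ s in (0 : ℝ)..t, ∑ k ∈ Fintype.piFinset (fun _ : Fin 3 => Finset.range m), pc ((m : ℝ) ^ 3 * mass N s m k) (temp N s m k) * ∑ j : Fin 3, vel N s m k j * gI m k j; let DL : ℕ → Prop := fun m => ∀ᶠ N : ℕ in Filter.atTop, ∀ s ∈ Set.Icc 0 t, ∀ k : Fin 3 → ℕ, (m : ℝ) ^ 3 * mass N s m k * σ ^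 3 ≤ ηc; let LG : ℝ → ℕ → Prop := fun δ m => ∀ᶠ N : ℕ in Filter.atTop, ∀ s ∈ Set.Icc 0 t, ∃ (ca cθ : (Fin 3 → ℕ) → ℝ) (cu : (Fin 3 → ℕ) → (EuclideanSpace ℝ (Fin 3))), (∀ k, 0 < ca k ∧ 0 < cθ k) ∧ InformationTheory.klDiv ((Φ N).lawAt (P N) s) (Literature.MathematicalPhysics.KineticTheory.localGibbsLaw σ (fun x => ca (idx m x)) (fun x => cu (idx m x)) (fun x => cθ (idx m x)) N (Φ N)) ≤ ENNReal.ofReal (δ * ((N : ℝ) + 1)); ∀ ε : ℝ, 0 < ε → ∃ δ : ℝ, 0 < δ ∧ ∃ m₀ : ℕ, ∀ m : ℕ, m₀ ≤ m → LG δ m → DL m → ∀ᶠ N : ℕ in Filter.atTop, (∀ j : Fin 3, |Rmom N j - Cmom N m j| ≤ ε) ∧ |Ren N - Cen N m| ≤ ε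

/-- item stmt-AtomisticToContinuum-9235 · crux · rank 4 · SPLIT (gen 1) into QuarticMixingFloorLagged, EnergyFluxCeilingWindows + glue Summit.AtomisticToContinuum.HydrodynamicLimit.Theorems.QuarticSchurLedger.EnergyCurrentTails_of_mixingFloor4L · direct attempts still welcome (low priority) · by planner
why it might fail: Energy is conserved only globally: after ≍N^{1/3} collisions per unit time a vanishing fraction of spheres could carry O(1) energy in the cubic tail; OllaVaradhanYau1993 removed exactly this by modifying the kinetic energy, impossible for hard spheres.
sources: OllaVaradhanYau1993, NachtergaeleYau2003, Spohn1991, Cercignani1988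
[crux] UNIFORM INTEGRABILITY OF THE CUBIC ENERGY CURRENT BEFORE THE FIRST SHOCK (shared typed crux
stmt-AtomisticToContinuum-3655 of route KineticWindows; the card's "cubic UI" conjunct X_T): for
continuous profiles ∃ σ₀ ∀ σ ∈ (0,σ₀) ∀ classical hs-Euler solutions on [0,T) ∀ flow families, if
the local Gibbs fields converge at t = 0 then ∀ t < T ∀ ε > 0 ∃ M ∃ N₀ ∀ N ≥ N₀ ∀ s ∈ [0,t]:
E[(N+1)⁻¹ Σ_i |v_i(s)|³ 1{|v_i(s)| > M}] ≤ ε. Needed here only for the energy equation (heat flux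
and (E+p)u): the quadratic momentum closure needs no tail input in this route (energy conservation +
the o(N) entropy bootstrap exclude sparse energy concentration, whose local-Gibbs cost is
extensive), but cubic mass on a vanishing fraction of particles has SUB-extensive cost. [difficulty:
open-problem] -/
@[route_item "route-AtomisticToContinuum-JaynesSqueeze", crux]
def EnergyCurrentTails : Prop :=
  ∀ (a₀ θ₀ : Literature.MathematicalPhysics.KineticTheory.T3 → ℝ) (u₀ : Literature.MathematicalPhysics.KineticTheory.T3 → Literature.MathematicalPhysics.KineticTheory.V3), Continuous a₀ → Continuous θ₀ → Continuous u₀ → (∀ x, 0 < a₀ x) → (∀ x, 0 < θ₀ x) → ∃ σ₀ : ℝ, 0 < σ₀ ∧ ∀ σ : ℝ, 0 < σ → σ < σ₀ → ∀ (T : ℝ) (ρ θ : ℝ → Literature.MathematicalPhysics.KineticTheory.T3 → ℝ) (u : ℝ → Literature.MathematicalPhysics.KineticTheory.T3 → Literature.MathematicalPhysics.KineticTheory.V3), Literature.MathematicalPhysics.KineticTheory.IsHardSphereEulerSolution σ T ρ u θ → ∀ Φ : (N : ℕ) → Literature.Analysis.FluidPDE.HardSphereFlow (Literature.Analysis.FluidPDE.Torus.geometry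 (Fin 3)) (Literature.MathematicalPhysics.KineticTheory.hsDiameter σ N) (N + 1), Literature.MathematicalPhysics.KineticTheory.TendstoHydroFieldsAt (fun N => Literature.MathematicalPhysics.KineticTheory.localGibbsLaw σ a₀ u₀ θ₀ N (Φ N)) Φ ρ u θ 0 → ∀ t ∈ Set.Ico 0 T, ∀ ε : ℝ, 0 < ε → ∃ M : ℝ, ∃ N₀ : ℕ, ∀ N : ℕ, N₀ ≤ N → ∀ s ∈ Set.Icc 0 t, ∫⁻ z, ENNReal.ofReal (((N : ℝ) + 1)⁻¹ * ∑ i : Fin (N + 1), Set.indicator {v : Literature.MathematicalPhysics.KineticTheory.V3 | M < ‖v‖} (fun v => ‖v‖ ^ 3) (((Φ N).flow s z i).2)) ∂(Literature.MathematicalPhysics.KineticTheory.localGibbsLaw σ a₀ u₀ θ₀ N (Φ N)) ≤ ENNReal.ofReal ε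

-- parent: EnergyCurrentTails · child (gen 1)
/--     item stmt-AtomisticToContinuum-18206 · crux · rank 401 · open
    parent: EnergyCurrentTails · by operator
    why it might fail: Corridors / three-body pre-emption under the evolved law: a positive |v|^4-fraction of lab-fast spheres may pass a kinetic window with no mixing collision (platoons, depleted forward tubes; emptying their tubes costs o(N) nats, beyond entropy); no sub-population rate floor exists past Lanford time.
    sources: MischlerMouhot2012, GallagherSaintRaymondTexier2013, Lanford1975, NachtergaeleYau2003, Literature.Barriers.AtomisticToContinuum.HighMomentumCutoffBarrierNarrow
[crux] THE LAGGED KINETIC-WINDOW QUARTIC MIXING FLOOR (QMF4L; child 1 of the strategist split of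
EnergyCurrentTails; = the registered stub stub_quarticMixingFloor4L of line quartic-schur-ledger
VERBATIM = Theorems.EnergyCurrentTailsFirstPartner.QuarticMixingFloor4L by Iff.rfl). Frame of the
conjunct (continuous positive profiles, sigma < sigma0, any horizon T > 0, any hard-sphere flow
family, local Gibbs data); EXISTS K0 >= 0, c > 0, N0 such that for N >= N0 and every kinetic window
(s, s + h_N], h_N = (N+1)^(-1/3), inside [0,T]: c * sigma^2 (N+1)^(1/3) * Integral over the FIRST
HALF-window of E[(N+1)^-1 Sum_{i : |v_i(tau)| > K0} |v_i(tau)|^4] dtau <= E[Sum over the collisions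
of the window, Sum over ordered contact pairs (i,j), 1{|v_i^-| > K0} (N+1)^-1 2|v_i^+|^2 |v_j^+|^2]
(v^- incoming via collidePair, v^+ outgoing read on the orbit). Informally: the |v|^4-content of the
lab-fast spheres seen during the first half of a kinetic window is paid for, at the thermal
collision rate c sigma^2 per kinetic time, by MIXING collisions of that window (Povzner gain of the
pair non-degenerate) - a one-rare-participant molecular-chaos FLOOR at the MESOSCOPIC scale under
the evolved law (no ins -/
@[route_item "route-AtomisticToContinuum-JaynesSqueeze", crux]
def QuarticMixingFloorLagged : Prop :=
  open Literature.MathematicalPhysics.KineticTheory Literature.Analysis.FluidPDE in ∀ (a₀ θ₀ : T3 → ℝ) (u₀ : T3 → V3), Continuous a₀ → Continuous θ₀ → Continuous u₀ → (∀ x, 0 < a₀ x) → (∀ x, 0 < θ₀ x) → ∃ σ₀ : ℝ, 0 < σ₀ ∧ ∀ σ : ℝ, 0 < σ → σ < σ₀ → ∀ T : ℝ, 0 < T → ∀ Φ : ((N : ℕ) → HardSphereFlow (Torus.geometry (Fin 3)) (hsDiameter σ N) (N + 1)), ∃ K₀ : ℝ, 0 ≤ K₀ ∧ ∃ c : ℝ,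 0 < c ∧ ∃ N₀ : ℕ, ∀ N : ℕ, N₀ ≤ N → ∀ s : ℝ, 0 ≤ s → s + ((N : ℝ) + 1) ^ (-(1 / 3 : ℝ)) ≤ T → ENNReal.ofReal (c * (σ ^ 2 * ((N + 1 : ℕ) : ℝ) ^ ((1 : ℝ) / 3))) * ∫⁻ τ in Set.Ioc s (s + ((N : ℝ) + 1) ^ (-(1 / 3 : ℝ)) / 2), (∫⁻ z, ENNReal.ofReal (((N + 1 : ℕ) : ℝ)⁻¹ * ∑ i : Fin (N + 1), if K₀ < ‖(((Φ N).flow τ z) i).2‖ then ‖(((Φ N).flow τ z) i).2‖ ^ 4 else 0) ∂(localGibbsLaw σ a₀ u₀ θ₀ N (Φ N))) ≤ ∫⁻ z, (∑ᶠ τ ∈ collisionTimes (Torus.geometry (Fin 3)) (hsDiameter σ N) (fun r => (Φ N).flow r z) ∩ Set.Ioc s (s + ((N : ℝ) + 1) ^ (-(1 / 3 : ℝ))), ∑ i : Fin (N + 1), ∑ j : Fin (N + 1), if i = j then (0 : ENNReal) else (contactSet (Torus.geometry (Fin 3)) (N + 1) (hsDiameter σ N) i j).indicator (fun y => if K₀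 < ‖((collidePair (Torus.geometry (Fin 3)) i j y) i).2‖ then ENNReal.ofReal (((N + 1 : ℕ) : ℝ)⁻¹ * (2 * (‖(y i).2‖ ^ 2 * ‖(y j).2‖ ^ 2))) else 0) ((Φ N).flow τ z)) ∂(localGibbsLaw σ a₀ u₀ θ₀ N (Φ N))

-- parent: EnergyCurrentTails · child (gen 1)
/--     item stmt-AtomisticToContinuum-18207 · crux · rank 402 · open
    parent: EnergyCurrentTails · by operator
    why it might fail: Dynamical over-production of fast-fast / fast-dense encounters under the evolved law (transient hot micro-clusters, focusing trees of non-vanishing weight): the upper half of one-sided chaos at contact, no tool at fixed reduced density beyond a fraction of a mean free time.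
    sources: Lanford1975, GallagherSaintRaymondTexier2013, CercignaniIllnerPulvirenti1994, Spohn1991, Literature.Barriers.AtomisticToContinuum.HighMomentumCutoffBarrierNarrow
[crux] THE BULK BILINEAR ENERGY-FLUX CEILING ON WINDOWS (S2a''; child 2 of the strategist split of
EnergyCurrentTails; = the registered stub stub_energyFluxCeilingWindows of line quartic-schur-ledger
VERBATIM). Frame of the conjunct; EXISTS C >= 0, N0 such that for N >= N0 and all 0 <= s <= s' <= T:
E[(N+1)^-1 Sum_{collisions in (s,s']} |v_1^-|^2 |v_2^-|^2] <= C * sigma^2 (N+1)^(1/3) (s'-s) *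
sup_{[s,s']} E[m_2] * sup_{[s,s']} E[m_3] (m_k = empirical k-th velocity moment). Informally: the
one bilinear mark the quartic gain lemma produces is produced by collisions at most at the
Stosszahlansatz rate - a NONE-RARE (bulk-mark) molecular-chaos CEILING under the evolved law;
Euler-free, all windows. TYPED PRODUCER: the shared item stmt-AtomisticToContinuum-16939
JeansLoadedDice.ContactIntensityDominationOneRare at psi = |.|^2, k = 2 (dock LANDED:
stub_energyFluxCeilingWindows_of_oneRare, p139311) - whoever proves 16939 closes this child by a
one-line composition. Certificates: rung 0 for all windows (p102898), rung 1/2 ratio <=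
(theta_max/theta_min)^(5/2) sup rho (seat c4 audit); no two-copy right-hand side, so the hot-spot
witness that refuted stmt-9218 (not_ContactIntensityDomination) -/
@[route_item "route-AtomisticToContinuum-JaynesSqueeze", crux]
def EnergyFluxCeilingWindows : Prop :=
  open Literature.MathematicalPhysics.KineticTheory Literature.Analysis.FluidPDE in ∀ (a₀ θ₀ : T3 → ℝ) (u₀ : T3 → V3), Continuous a₀ → Continuous θ₀ → Continuous u₀ → (∀ x, 0 < a₀ x) → (∀ x, 0 < θ₀ x) → ∃ σ₀ : ℝ, 0 < σ₀ ∧ ∀ σ : ℝ, 0 < σ → σ < σ₀ → ∀ T : ℝ, 0 < T → ∀ Φ : ((N : ℕ) → HardSphereFlow (Torus.geometry (Fin 3)) (hsDiameter σ N) (N + 1)), ∃ C : ℝ, 0 ≤ C ∧ ∃ N₀ : ℕ, ∀ N : ℕ, N₀ ≤ N → ∀ s s' : ℝ, 0 ≤ s → s ≤ s' → s' ≤ T → (∫⁻ z, ENNReal.ofReal (((N : ℝ) + 1)⁻¹ * (Φ N).collisionSum (Set.Ioc s s') (fun col => ‖col.preVel.1‖ ^ 2 * ‖col.preVel.2‖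 ^ 2) z) ∂(localGibbsLaw σ a₀ u₀ θ₀ N (Φ N))) ≤ ENNReal.ofReal (C * (σ ^ 2 * ((N : ℝ) + 1) ^ (1 / 3 : ℝ) * (s' - s))) * (⨆ r ∈ Set.Icc s s', (∫⁻ z, ENNReal.ofReal (((N : ℝ) + 1)⁻¹ * ∑ i : Fin (N + 1), ‖((Φ N).flow r z i).2‖ ^ 2) ∂(localGibbsLaw σ a₀ u₀ θ₀ N (Φ N)))) * (⨆ r ∈ Set.Icc s s', (∫⁻ z, ENNReal.ofReal (((N : ℝ) + 1)⁻¹ * ∑ i : Fin (N + 1), ‖((Φ N).flow r z i).2‖ ^ 3) ∂(localGibbsLaw σ a₀ u₀ θ₀ N (Φ N))))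

/-- glue for the split of `EnergyCurrentTails`: landed theorem `Summit.AtomisticToContinuum.HydrodynamicLimit.Theorems.QuarticSchurLedger.EnergyCurrentTails_of_mixingFloor4L`. -/
theorem EnergyCurrentTailsGlueBy_holds : QuarticMixingFloorLagged → EnergyFluxCeilingWindows → EnergyCurrentTails := _root_.Summit.AtomisticToContinuum.HydrodynamicLimit.Theorems.QuarticSchurLedger.EnergyCurrentTails_of_mixingFloor4L

/-- item stmt-AtomisticToContinuum-13458 · crux · rank 5 · open · by planner
why it might fail: Conjunct-strength a priori: fails iff the MEAN block density leaves [ρmin/2, 2ρmax] (vacuum / over-compression) or the block kinetic temperature leaves [θmin/2, 2θmax] before T, i.e. iff hydrodynamics itself fails; no dynamical bound on mean fields is known.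
sources: Spohn1991, OllaVaradhanYau1993, Dafermos1979
[crux] (a-priori non-degeneracy of the MEAN block profile, dilute-guarded; load-bearing: compact
conjugate parameters for the uniform LDA and Dafermos' compact K) under the conjunct's hypotheses, t
< T and packing ρ_sσ³ ≤ ηc on [0,t]: ∃ m₀ ∀ m ≥ m₀, eventually in N, for all s ≤ t and all cubes B
of side 1/m: m³m_B ∈ [½ inf ρ, 2 sup ρ], θ_B ∈ [½ inf θ, 2 sup θ], |u_B| ≤ 1 + sup|u| (inf/sup of
the classical solution over [0,t] × 𝕋³; m₀ absorbs the in-block velocity variance). Implied by the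
conjunct (+ energy UI); now ranked so that it is staffed and refutable on its own. [difficulty:
open-problem] -/
@[route_item "route-AtomisticToContinuum-JaynesSqueeze", crux]
def MeanBlocksInRange : Prop :=
  ∀ (a₀ θ₀ : (UnitAddTorus (Fin 3)) → ℝ) (u₀ : (UnitAddTorus (Fin 3)) → (EuclideanSpace ℝ (Fin 3))), Continuous a₀ → Continuous θ₀ → Continuous u₀ → (∀ x, 0 < a₀ x) → (∀ x, 0 < θ₀ x) → ∃ σ₀ : ℝ, 0 < σ₀ ∧ ∃ ηc : ℝ, 0 < ηc ∧ ∀ σ : ℝ, 0 < σ → σ < σ₀ → ∀ (T : ℝ) (ρ θ : ℝ → (UnitAddTorus (Fin 3)) → ℝ) (u : ℝ → (UnitAddTorus (Fin 3)) → (EuclideanSpace ℝ (Fin 3))), Literature.MathematicalPhysics.KineticTheory.IsHardSphereEulerSolution σ T ρ u θ → ∀ Φ : (N : ℕ) → Literature.Analysis.FluidPDE.HardSphereFlow (Literature.Analysis.FluidPDE.Torus.geometry (Fin 3)) (Literature.MathematicalPhysics.KineticTheory.hsDiameter σ N) (N + 1), Literature.MathematicalPhysics.KineticTheory.TendstoHydroFieldsAt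 (fun N => Literature.MathematicalPhysics.KineticTheory.localGibbsLaw σ a₀ u₀ θ₀ N (Φ N)) Φ ρ u θ 0 → ∀ t ∈ Set.Ico 0 T, (∀ s ∈ Set.Icc 0 t, ∀ x, ρ s x * σ ^ 3 ≤ ηc) → let P : (N : ℕ) → MeasureTheory.Measure (Literature.Analysis.FluidPDE.Config (N + 1) (Fin 3) (UnitAddTorus (Fin 3))) := fun N => Literature.MathematicalPhysics.KineticTheory.localGibbsLaw σ a₀ u₀ θ₀ N (Φ N); let μ : (N : ℕ) → ℝ → MeasureTheory.Measure ((UnitAddTorus (Fin 3)) × (EuclideanSpace ℝ (Fin 3))) := fun N s => ((N : ENNReal) + 1)⁻¹ • MeasureTheory.Measure.sum (fun i : Fin (N + 1) => ((Φ N).lawAt (P N) s).map (fun z => z i)); let idx : ℕ → (UnitAddTorus (Fin 3)) → (Fin 3 → ℕ) := fun m x i => ⌊(m : ℝ) * Literature.Analysis.FunctionSpaces.Torus.repr x i⌋₊; let μB : ℕ → ℝ → ℕ → (Fin 3 → ℕ) → MeasureTheory.Measure (EuclideanSpace ℝ (Fin 3)) := fun N s m k => ((μ N s).restrict ({x : (UnitAddTorus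 (Fin 3)) | idx m x = k} ×ˢ (Set.univ : Set (EuclideanSpace ℝ (Fin 3))))).snd; let mass : ℕ → ℝ → ℕ → (Fin 3 → ℕ) → ℝ := fun N s m k => ((μB N s m k) Set.univ).toReal; let vel : ℕ → ℝ → ℕ → (Fin 3 → ℕ) → (EuclideanSpace ℝ (Fin 3)) := fun N s m k => (mass N s m k)⁻¹ • ∫ v, v ∂(μB N s m k); let temp : ℕ → ℝ → ℕ → (Fin 3 → ℕ) → ℝ := fun N s m k => (3 * mass N s m k)⁻¹ * ∫ v, ‖v - vel N s m k‖ ^ 2 ∂(μB N s m k); ∃ m₀ : ℕ, ∀ m : ℕ, m₀ ≤ m → ∀ᶠ N : ℕ in Filter.atTop, ∀ s ∈ Set.Icc 0 t, ∀ k ∈ Fintype.piFinset (fun _ : Fin 3 => Finset.range m), (⨅ q : Set.Icc 0 t × (UnitAddTorus (Fin 3)), ρ q.1 q.2) / 2 ≤ (m : ℝ) ^ 3 * mass N s m k ∧ (m : ℝ) ^ 3 * mass N s m k ≤ 2 * ⨆ q : Set.Icc 0 t × (UnitAddTorus (Fin 3)), ρ q.1 q.2 ∧ (⨅ q : Set.Icc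 0 t × (UnitAddTorus (Fin 3)), θ q.1 q.2) / 2 ≤ temp N s m k ∧ temp N s m k ≤ 2 * ⨆ q : Set.Icc 0 t × (UnitAddTorus (Fin 3)), θ q.1 q.2 ∧ ‖vel N s m k‖ ≤ 1 + ⨆ q : Set.Icc 0 t × (UnitAddTorus (Fin 3)), ‖u q.1 q.2‖

/-- item stmt-AtomisticToContinuum-3091 · crux · rank 6 · open · by planner
why it might fail: DenseExcursion (γ=5/3 smooth implosion tracked by the σ-family; MerleEtAl2022, BuckmasterCaolaboraGomezserrano2025 on 𝕋³) would refute it; even if true it is a σ-uniform density bound at the FIRST singularity of 3-D Euler for all smooth profiles.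
sources: Sideris1985, LukSpeck2024, MerleEtAl2022, BuckmasterCaolaboraGomezserrano2025, CaolaboraEtAl2025, Spohn1991
[crux] (card crux 1B ∪ 3; the hidden PDE crux of every route) for every η > 0 and all continuous
positive profiles there is σ₀ > 0 such that for 0 < σ < σ₀, every classical hard-sphere-Euler
solution on [0,T) whose t = 0 fields are the LLN limit of the local Gibbs laws satisfies ρ_t(x)σ³ <
η for all t < T and x — i.e. limsup_{σ→0} σ³ sup_{t<T*_σ} ‖ρ_σ(t)‖_∞ = 0 profile by profile. For
profiles whose ideal-gas development is global or breaks by a non-degenerate shock (Luk–Speck /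
Buckmaster–Shkoller–Vicol open sets) this is stability of shock formation under an O(σ³)
equation-of-state and data perturbation; in general it is a σ-uniform density bound at the FIRST
singularity of 3-D compressible Euler for all smooth data. [deps: EosContinuity,
LocalGibbsDensityLimit] [difficulty: open-problem] -/
@[route_item "route-AtomisticToContinuum-JaynesSqueeze", crux]
def DiluteSelfConsistency : Prop :=
  ∀ η : ℝ, 0 < η → ∀ (a₀ θ₀ : Literature.MathematicalPhysics.KineticTheory.T3 → ℝ) (u₀ : Literature.MathematicalPhysics.KineticTheory.T3 → Literature.MathematicalPhysics.KineticTheory.V3), Continuous a₀ → Continuous θ₀ → Continuous u₀ → (∀ x, 0 < a₀ x) → (∀ x, 0 < θ₀ x) → ∃ σ₀ : ℝ, 0 < σ₀ ∧ ∀ σ : ℝ, 0 < σ → σ < σ₀ → ∀ (T : ℝ) (ρ θ : ℝ → Literature.MathematicalPhysics.KineticTheory.T3 → ℝ) (u : ℝ → Literature.MathematicalPhysics.KineticTheory.T3 → Literature.MathematicalPhysics.KineticTheory.V3), Literature.MathematicalPhysics.KineticTheory.IsHardSphereEulerSolution σ T ρ u θ → ∀ Φ : (N : ℕ) → Literature.Analysis.FluidPDE.HardSphereFlow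 (Literature.Analysis.FluidPDE.Torus.geometry (Fin 3)) (Literature.MathematicalPhysics.KineticTheory.hsDiameter σ N) (N + 1), Literature.MathematicalPhysics.KineticTheory.TendstoHydroFieldsAt (fun N => Literature.MathematicalPhysics.KineticTheory.localGibbsLaw σ a₀ u₀ θ₀ N (Φ N)) Φ ρ u θ 0 → ∀ t ∈ Set.Ico 0 T, ∀ x, ρ t x * σ ^ 3 < η

/-- item stmt-AtomisticToContinuum-16266 · crux · rank 7 · open · by planner
why it might fail: As one step it is L+: the squeeze needs the LDA uniform over N-dependent block parameters; the closure needs MEAN-field convergence from o(N) block Gibbsianity, where K2 is typed at fixed endpoints (N₀ = N₀(s)) but Dafermos' stability consumes a sup-in-s residual (memo v3 on stmt-13464).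
sources: Yau1991, OllaVaradhanYau1993, Dafermos1979, Csiszar1975, Jaynes1965, SaintRaymond2009
[crux] (the derivation X ⟹ Yau's target, crux-grade; filed 2026-08-16 by route-repair so that the
deciding theorem assumes cruxes only) NoMeanEntropyProduction → CollisionalFluxLocality →
EnergyCurrentTails → MeanBlocksInRange → DiluteSelfConsistency → RelEntropyVanishing: the five
dynamical cruxes imply Yau's relative-entropy target (0766). It is the composite of the route's
filed support chain — SqueezeToBlockGibbs (13463: K1 + R + statics ⟹ BlockGibbs, M),
BlockGibbsToRelEntropy (13464: BlockGibbs + K2 + K4 + R + Dafermos + statics ⟹ 0766, L),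
EntropicWeakStrongHS (13461, known-type L), LocalGibbsConcentrationDilute (13460, known-type M),
HardSphereLDA (13459, PROVED), HsEosLowDensity (0768, PROVED) — glue, pure logic (Sketch.lean rc0):
`fun hS hB hW hL h₁ h₂ h₃ h₄ h₅ => hB (hS h₁ h₄ hLDA hEos h₅) h₂ h₃ h₄ hW hLDA hL hEos h₅` with hLDA
:= Theorems.hardSphereLDA_proof, hEos := HsEosLowDensity_holds; those supports stay filed verbatim
(landed Theorems/JaynesSqueeze*.lean reference them by name) and are its lemmas, not hypotheses of
`closes`. State of the art inside the tree (2026-08-16):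
Theorems/JaynesSqueezeBlockGibbsToRelEntropy{Reduction,Core}.lean (JaynesSqueezeClosure.relEnt -/
@[route_item "route-AtomisticToContinuum-JaynesSqueeze", crux]
def SqueezeClosure : Prop :=
  NoMeanEntropyProduction → CollisionalFluxLocality → EnergyCurrentTails → MeanBlocksInRange → DiluteSelfConsistency → RelEntropyVanishing

/-- item stmt-AtomisticToContinuum-0768 · support · rank 9 · closed · proved by Summit.AtomisticToContinuum.HydrodynamicLimit.Theorems.hsEosLowDensity_proof (prover) · by planner
sources: Ruelle1969, LebowitzPenrose1964
[support] Hard-sphere equation of state at low density: ∃ η₀ > 0 and F real-analytic on (−η₀, η₀)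
with hsExcessFreeEnergy = F on [0, η₀), F(0) = 0, F'(0) = 2π/3 (second virial coefficient of
unit-diameter spheres), and the canonical thermodynamic limit −N⁻¹ log hsFreeVolume η N → F(η)
exists (not just limsup) for η ∈ [0, η₀). Ruelle1969 §3.4 (existence), LebowitzPenrose1964
(convergence of the virial expansion ⇒ analyticity). Makes hsCompressibility/hsPressure smooth and
Z(η) = 1 + (2π/3)η + O(η²); needed by every route (hyperbolicity of the Euler system, virial
theorem). -/
@[route_item "route-AtomisticToContinuum-JaynesSqueeze"]
def HsEosLowDensity : Prop :=
  ∃ η₀ : ℝ, 0 < η₀ ∧ ∃ F : ℝ → ℝ, AnalyticOnNhd ℝ F (Set.Ioo (-η₀) η₀) ∧ Set.EqOn Literature.MathematicalPhysics.KineticTheory.hsExcessFreeEnergy F (Set.Ico 0 η₀) ∧ F 0 = 0 ∧ deriv F 0 = 2 * Real.pi / 3 ∧ ∀ η ∈ Set.Ico 0 η₀, Filter.Tendsto (fun N : ℕ => -(N : ℝ)⁻¹ * Real.log (Literature.MathematicalPhysics.KineticTheory.hsFreeVolume η N)) Filter.atTop (nhds (F η))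

/-- `HsEosLowDensity` holds: proved by `Summit.AtomisticToContinuum.HydrodynamicLimit.Theorems.hsEosLowDensity_proof`. -/
theorem HsEosLowDensity_holds : HsEosLowDensity := _root_.Summit.AtomisticToContinuum.HydrodynamicLimit.Theorems.hsEosLowDensity_proof

/-- item stmt-AtomisticToContinuum-13459 · support · rank 9 · closed · proved by Summit.AtomisticToContinuum.HydrodynamicLimit.Theorems.hardSphereLDA_proof @ dbcbe4c5a07a (prover) · by planner
sources: Ruelle1969, LebowitzPenrose1964, PulvirentiTsagkarogiannis2012, JansenKunaTsagkarogiannis2023, HelmuthPerkinsPetti2022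
[support] (static LDA package, canonical inhomogeneous dilute hard-sphere gas on 𝕋³; packing-only
smallness) HsEosLowDensity → ∃ η₁ > 0 ∀ σ > 0: (A) every measurable activity with Λ⁻¹ ≤ a ≤ Λ, Λ²σ³
≤ η₁ is e^c ρ e^(g_σ(ρ)) for a normalised measurable density ρ ∈ [(2Λ²)⁻¹, 2Λ²], g_σ(r) = f_ex(rσ³)
+ rσ³f_ex′(rσ³) (used only for the DATA profile, whose contrast is fixed before σ); (B) for every
normalised measurable density ρ ≥ c > 0 with ρσ³ ≤ η₁, activity ρ e^(g_σ(ρ)) and measurable velocity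
/ positive temperature profiles: (N+1)⁻¹ log canonicalPartition → ∫ρ · ρσ³f_ex′(ρσ³), the laws are
probability measures, the MEAN empirical density → ρ (block-constant profiles included). Technology
of the tree's HardSphereCanonicalTorus / HardSphereEulerRatio. [difficulty: M] -/
@[route_item "route-AtomisticToContinuum-JaynesSqueeze", crux]
def HardSphereLDA : Prop :=
  HsEosLowDensity → ∃ η₁ : ℝ, 0 < η₁ ∧ ∀ σ : ℝ, 0 < σ → let g : ℝ → ℝ := fun r => Literature.MathematicalPhysics.KineticTheory.hsExcessFreeEnergy (r * σ ^ 3) + r * σ ^ 3 * deriv Literature.MathematicalPhysics.KineticTheory.hsExcessFreeEnergy (r * σ ^ 3); (∀ Λ : ℝ, 1 ≤ Λ → Λ ^ 2 * σ ^ 3 ≤ η₁ → ∀ a : (UnitAddTorus (Fin 3)) → ℝ, Measurable a → (∀ x, Λ⁻¹ ≤ a x ∧ a x ≤ Λ) → ∃ ρa : (UnitAddTorus (Fin 3)) → ℝ, Measurable ρa ∧ (∀ x, (2 * Λ ^ 2)⁻¹ ≤ ρa x ∧ ρa x ≤ 2 * Λ ^ 2) ∧ ∫ x, ρa x = 1 ∧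 ∃ c : ℝ, ∀ x, a x = Real.exp c * ρa x * Real.exp (g (ρa x))) ∧ (∀ c : ℝ, 0 < c → ∀ ρ₁ : (UnitAddTorus (Fin 3)) → ℝ, Measurable ρ₁ → (∀ x, c ≤ ρ₁ x ∧ ρ₁ x * σ ^ 3 ≤ η₁) → ∫ x, ρ₁ x = 1 → ∀ (u₁ : (UnitAddTorus (Fin 3)) → (EuclideanSpace ℝ (Fin 3))) (θ₁ : (UnitAddTorus (Fin 3)) → ℝ), Measurable u₁ → Measurable θ₁ → (∀ x, 0 < θ₁ x) → ∀ Φ : (N : ℕ) → Literature.Analysis.FluidPDE.HardSphereFlow (Literature.Analysis.FluidPDE.Torus.geometry (Fin 3)) (Literature.MathematicalPhysics.KineticTheory.hsDiameter σ N) (N + 1), let a₁ : (UnitAddTorus (Fin 3)) → ℝ := fun x => ρ₁ x * Real.exp (g (ρ₁ x)); Filter.Tendsto (fun N : ℕ => ((N : ℝ) + 1)⁻¹ * Real.log (Literature.Analysis.FluidPDE.canonicalPartition (Literature.Analysis.FluidPDE.Torus.geometry (Fin 3)) (Literature.MathematicalPhysics.KineticTheory.hsDiameter σ N) (N + 1)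 (Literature.MathematicalPhysics.KineticTheory.localGibbsProfile a₁ u₁ θ₁))) Filter.atTop (nhds (∫ x, ρ₁ x * (ρ₁ x * σ ^ 3 * deriv Literature.MathematicalPhysics.KineticTheory.hsExcessFreeEnergy (ρ₁ x * σ ^ 3)))) ∧ (∀ N, MeasureTheory.IsProbabilityMeasure (Literature.MathematicalPhysics.KineticTheory.localGibbsLaw σ a₁ u₁ θ₁ N (Φ N))) ∧ ∀ χ : (UnitAddTorus (Fin 3)) → ℝ, Continuous χ → Filter.Tendsto (fun N : ℕ => ∫ z, Literature.MathematicalPhysics.KineticTheory.empiricalDensityField z χ ∂(Literature.MathematicalPhysics.KineticTheory.localGibbsLaw σ a₁ u₁ θ₁ N (Φ N))) Filter.atTop (nhds (∫ x, χ x * ρ₁ x)))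

/-- item stmt-AtomisticToContinuum-13460 · support · rank 9 · closed · proved by Summit.AtomisticToContinuum.HydrodynamicLimit.Theorems.localGibbsConcentrationDilute_proof @ 0a28301590ed (prover) · by planner
sources: Ruelle1969, LebowitzPenrose1964, Spohn1991, Georgii1994
[support] (exponential LLN, packing-only smallness; replaces 9246/0767, which is not dischargeable
for the σ-dependent Euler-driven reference) HsEosLowDensity → ∃ η₁ > 0 ∀ σ > 0 ∀ c > 0: for
continuous normalised ρ₁ ≥ c with ρ₁σ³ ≤ η₁, continuous u₁, θ₁ > 0, activity a₁ = ρ₁ e^(g_σ(ρ₁)),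
every continuous χ and δ > 0 admit C > 0 with, for all N and flows, local-Gibbs probability of a
deviation > δ of the empirical density / momentum / energy field from ∫χρ₁, ∫χρ₁u₁, ∫χE(ρ₁,u₁,θ₁) at
most C e^(−(N+1)/C). Tilted partition functions + LDA + analytic local pressure; Gaussian velocities
given positions. [difficulty: M] -/
@[route_item "route-AtomisticToContinuum-JaynesSqueeze"]
def LocalGibbsConcentrationDilute : Prop :=
  HsEosLowDensity → ∃ η₁ : ℝ, 0 < η₁ ∧ ∀ σ : ℝ, 0 < σ → let g : ℝ → ℝ := fun r => Literature.MathematicalPhysics.KineticTheory.hsExcessFreeEnergy (r * σ ^ 3) + r * σ ^ 3 * deriv Literature.MathematicalPhysics.KineticTheory.hsExcessFreeEnergy (r * σ ^ 3); ∀ c : ℝ, 0 < c → ∀ ρ₁ : (UnitAddTorus (Fin 3)) → ℝ, Continuous ρ₁ → (∀ x, c ≤ ρ₁ x ∧ ρ₁ x * σ ^ 3 ≤ η₁) → ∫ x, ρ₁ x = 1 → ∀ (u₁ : (UnitAddTorus (Fin 3)) → (EuclideanSpace ℝ (Fin 3))) (θ₁ : (UnitAddTorus (Fin 3)) → ℝ),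 Continuous u₁ → Continuous θ₁ → (∀ x, 0 < θ₁ x) → let a₁ : (UnitAddTorus (Fin 3)) → ℝ := fun x => ρ₁ x * Real.exp (g (ρ₁ x)); ∀ χ : (UnitAddTorus (Fin 3)) → ℝ, Continuous χ → ∀ δ : ℝ, 0 < δ → ∃ C : ℝ, 0 < C ∧ ∀ (N : ℕ) (Φ : Literature.Analysis.FluidPDE.HardSphereFlow (Literature.Analysis.FluidPDE.Torus.geometry (Fin 3)) (Literature.MathematicalPhysics.KineticTheory.hsDiameter σ N) (N + 1)), Literature.MathematicalPhysics.KineticTheory.localGibbsLaw σ a₁ u₁ θ₁ N Φ {z | δ < |Literature.MathematicalPhysics.KineticTheory.empiricalDensityField z χ - ∫ x, χ x * ρ₁ x|} ≤ ENNReal.ofReal (C * Real.exp (-(C⁻¹ * (N + 1)))) ∧ Literature.MathematicalPhysics.KineticTheory.localGibbsLaw σ a₁ u₁ θ₁ N Φ {z | δ < ‖Literature.MathematicalPhysics.KineticTheory.empiricalMomentumField z χ - ∫ x, (χ x * ρ₁ x) • u₁ x‖} ≤ ENNReal.ofReal (C * Real.exp (-(C⁻¹ * (N + 1)))) ∧ Literature.MathematicalPhysics.KineticTheory.localGibbsLaw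 σ a₁ u₁ θ₁ N Φ {z | δ < |Literature.MathematicalPhysics.KineticTheory.empiricalEnergyField z χ - ∫ x, χ x * Literature.MathematicalPhysics.KineticTheory.totalEnergyDensity (ρ₁ x) (u₁ x) (θ₁ x)|} ≤ ENNReal.ofReal (C * Real.exp (-(C⁻¹ * (N + 1))))

/-- item stmt-AtomisticToContinuum-13461 · support · rank 9 · closed · proved by Summit.AtomisticToContinuum.HydrodynamicLimit.Theorems.EntropicWeakStrong.entropicWeakStrongHS_proof @ 99d40450dfc6 (prover) · by planner
sources: Dafermos1979, BrezinaFeireisl2018, GwiazdaSwierczewskagwiazdaWiedemann2015, BerthelinVasseur2005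
[support] (card S5; Dafermos stability for hs-Euler on 𝕋³ in A-PRIORI form with ONLY the global
entropy inequality) HsEosLowDensity → ∃ η₀: for a classical solution U with packing < η₀ on [0,T), t
< T, a compact K in the positivity/low-packing region and ε > 0 there is δ > 0 such that every
measurable K-valued V(s,x) with ∫h_σ(V(s)) ≤ ∫h_σ(U(0)) + δ on [0,t] (h_σ = −ρs_σ in conservative
variables), ‖V(0) − U(0)‖²_(L²) ≤ δ and weak-form residual against the entropy variables λ^E =
Dh_σ(U) at most δ on [0,t] satisfies ‖V(s) − U(s)‖²_(L²) ≤ ε on [0,t]. ℰ = ∫[h(V) − h(U) − λ^E·(V −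
U)], entropy–flux compatibility, Gronwall; strict convexity on K from HsEosLowDensity. [difficulty:
L] -/
@[route_item "route-AtomisticToContinuum-JaynesSqueeze"]
def EntropicWeakStrongHS : Prop :=
  HsEosLowDensity → ∃ η₀ : ℝ, 0 < η₀ ∧ ∀ σ : ℝ, 0 < σ → ∀ (T : ℝ) (ρ θ : ℝ → (UnitAddTorus (Fin 3)) → ℝ) (u : ℝ → (UnitAddTorus (Fin 3)) → (EuclideanSpace ℝ (Fin 3))), Literature.MathematicalPhysics.KineticTheory.IsHardSphereEulerSolution σ T ρ u θ → (∀ s ∈ Set.Ico 0 T, ∀ x, ρ s x * σ ^ 3 < η₀) → ∀ t ∈ Set.Ico 0 T, ∀ K : Set (ℝ × (EuclideanSpace ℝ (Fin 3)) × ℝ), IsCompact K → K ⊆ {U : ℝ × (EuclideanSpace ℝ (Fin 3)) × ℝ | 0 < U.1 ∧ U.1 * σ ^ 3 < η₀ ∧ ‖U.2.1‖ ^ 2 < 2 * U.1 * U.2.2} → ∀ ε : ℝ, 0 < ε → ∃ δ : ℝ, 0 < δ ∧ ∀ V : ℝ → (UnitAddTorus (Fin 3)) → ℝ × (EuclideanSpace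 ℝ (Fin 3)) × ℝ, Measurable (Function.uncurry V) → (∀ s x, V s x ∈ K) → let θo : ℝ × (EuclideanSpace ℝ (Fin 3)) × ℝ → ℝ := fun U => 2 / 3 * (U.2.2 / U.1 - ‖U.2.1‖ ^ 2 / (2 * U.1 ^ 2)); let h : ℝ × (EuclideanSpace ℝ (Fin 3)) × ℝ → ℝ := fun U => -(U.1 * (3 / 2 * Real.log (θo U) - Real.log U.1 - Literature.MathematicalPhysics.KineticTheory.hsExcessFreeEnergy (U.1 * σ ^ 3))); let Ucl : ℝ → (UnitAddTorus (Fin 3)) → ℝ × (EuclideanSpace ℝ (Fin 3)) × ℝ := fun s x => (ρ s x, ρ s x • u s x, Literature.MathematicalPhysics.KineticTheory.totalEnergyDensity (ρ s x) (u s x) (θ s x)); let lam : ℝ → (UnitAddTorus (Fin 3)) → ℝ × (EuclideanSpace ℝ (Fin 3)) × ℝ := fun s x => (-(3 / 2 * Real.log (θ s x) - Real.log (ρ s x) - Literature.MathematicalPhysics.KineticTheory.hsExcessFreeEnergy (ρ s x * σ ^ 3)) + 5 / 2 - ‖u s x‖ ^ 2 / (2 * θ s x) + ρ s x * σ ^ 3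 * deriv Literature.MathematicalPhysics.KineticTheory.hsExcessFreeEnergy (ρ s x * σ ^ 3), (θ s x)⁻¹ • u s x, -(θ s x)⁻¹); let flux : Fin 3 → ℝ × (EuclideanSpace ℝ (Fin 3)) × ℝ → ℝ × (EuclideanSpace ℝ (Fin 3)) × ℝ := fun i U => (U.2.1 i, (U.2.1 i / U.1) • U.2.1 + Literature.MathematicalPhysics.KineticTheory.hsPressure σ U.1 (θo U) • EuclideanSpace.single i (1 : ℝ), (U.2.2 + Literature.MathematicalPhysics.KineticTheory.hsPressure σ U.1 (θo U)) * U.2.1 i / U.1); let pair : (ℝ × (EuclideanSpace ℝ (Fin 3)) × ℝ) → (ℝ × (EuclideanSpace ℝ (Fin 3)) × ℝ) → ℝ := fun L U => L.1 * U.1 + (∑ j : Fin 3, L.2.1 j * U.2.1 j) + L.2.2 * U.2.2; let W : ℝ → ℝ := fun s => (∫ x, pair (lam s x) (V s x)) - (∫ x, pair (lam 0 x) (V 0 x)) - ∫ τ in (0 : ℝ)..s, ∫ x, (pair (Literature.Analysis.FunctionSpaces.Torus.timeDerivWithin (Set.Ico 0 T) lam τ x) (V τ x) + ∑ i : Fin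 3, pair (Literature.Analysis.FunctionSpaces.Torus.partialDeriv i (lam τ) x) (flux i (V τ x))); let dist2 : ℝ → ℝ := fun s => ∫ x, ((V s x).1 - (Ucl s x).1) ^ 2 + ‖(V s x).2.1 - (Ucl s x).2.1‖ ^ 2 + ((V s x).2.2 - (Ucl s x).2.2) ^ 2; (∀ s ∈ Set.Icc 0 t, ∫ x, h (V s x) ≤ (∫ x, h (Ucl 0 x)) + δ) → dist2 0 ≤ δ → (∀ s ∈ Set.Icc 0 t, |W s| ≤ δ) → ∀ s ∈ Set.Icc 0 t, dist2 s ≤ ε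

/-- item stmt-AtomisticToContinuum-13462 · support · rank 9 · open · by planner
sources: Yau1991, Csiszar1975, OllaVaradhanYau1993
[support] (typed waypoint: block local Gibbsianity in specific relative entropy with parameters in a
compact range; dilute-guarded) under the conjunct's hypotheses, t < T and packing ρ_sσ³ ≤ ηc on
[0,t]: ∃ A, Θ > 0, V such that ∀ δ>0 ∃ m₀ ∀ m ≥ m₀, eventually in N, for all s ≤ t there are
block-constant parameters (ca, cu, cθ) at scale m with A⁻¹ ≤ ca ≤ A, Θ⁻¹ ≤ cθ ≤ Θ, |cu| ≤ V and
klDiv(lawAt Φ_N P_N s ‖ localGibbsLaw σ ca(idx) cu(idx) cθ(idx)) ≤ δ(N+1). Exactly the hypothesis LG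
of CollisionalFluxLocality; Yau's local-equilibrium statement at the moment-matched (I-projection)
reference. [difficulty: open-problem] -/
@[route_item "route-AtomisticToContinuum-JaynesSqueeze"]
def BlockGibbs : Prop :=
  ∀ (a₀ θ₀ : (UnitAddTorus (Fin 3)) → ℝ) (u₀ : (UnitAddTorus (Fin 3)) → (EuclideanSpace ℝ (Fin 3))), Continuous a₀ → Continuous θ₀ → Continuous u₀ → (∀ x, 0 < a₀ x) → (∀ x, 0 < θ₀ x) → ∃ σ₀ : ℝ, 0 < σ₀ ∧ ∃ ηc : ℝ, 0 < ηc ∧ ∀ σ : ℝ, 0 < σ → σ < σ₀ → ∀ (T : ℝ) (ρ θ : ℝ → (UnitAddTorus (Fin 3)) → ℝ) (u : ℝ → (UnitAddTorus (Fin 3)) → (EuclideanSpace ℝ (Fin 3))), Literature.MathematicalPhysics.KineticTheory.IsHardSphereEulerSolution σ T ρ u θ → ∀ Φ : (N : ℕ) → Literature.Analysis.FluidPDE.HardSphereFlow (Literature.Analysis.FluidPDE.Torus.geometry (Fin 3)) (Literature.MathematicalPhysics.KineticTheory.hsDiameter σ N) (N + 1), Literature.MathematicalPhysics.KineticTheory.TendstoHydroFieldsAt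 (fun N => Literature.MathematicalPhysics.KineticTheory.localGibbsLaw σ a₀ u₀ θ₀ N (Φ N)) Φ ρ u θ 0 → ∀ t ∈ Set.Ico 0 T, (∀ s ∈ Set.Icc 0 t, ∀ x, ρ s x * σ ^ 3 ≤ ηc) → let P : (N : ℕ) → MeasureTheory.Measure (Literature.Analysis.FluidPDE.Config (N + 1) (Fin 3) (UnitAddTorus (Fin 3))) := fun N => Literature.MathematicalPhysics.KineticTheory.localGibbsLaw σ a₀ u₀ θ₀ N (Φ N); let idx : ℕ → (UnitAddTorus (Fin 3)) → (Fin 3 → ℕ) := fun m x i => ⌊(m : ℝ) * Literature.Analysis.FunctionSpaces.Torus.repr x i⌋₊; ∃ A Θ V : ℝ, 0 < A ∧ 0 < Θ ∧ ∀ δ : ℝ, 0 < δ → ∃ m₀ : ℕ, ∀ m : ℕ, m₀ ≤ m → ∀ᶠ N : ℕ in Filter.atTop, ∀ s ∈ Set.Icc 0 t, ∃ (ca cθ : (Fin 3 → ℕ) → ℝ) (cu : (Fin 3 → ℕ) → (EuclideanSpace ℝ (Fin 3))), (∀ k, A⁻¹ ≤ ca k ∧ ca k ≤ A ∧ Θ⁻¹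 ≤ cθ k ∧ cθ k ≤ Θ ∧ ‖cu k‖ ≤ V) ∧ InformationTheory.klDiv ((Φ N).lawAt (P N) s) (Literature.MathematicalPhysics.KineticTheory.localGibbsLaw σ (fun x => ca (idx m x)) (fun x => cu (idx m x)) (fun x => cθ (idx m x)) N (Φ N)) ≤ ENNReal.ofReal (δ * ((N : ℝ) + 1))

/-- item stmt-AtomisticToContinuum-13463 · support · rank 9 · closed · proved by Summit.AtomisticToContinuum.HydrodynamicLimit.Theorems.JaynesSqueezeSqueeze.squeezeToBlockGibbs_proof @ 2703b96a552a (prover) · by planner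
sources: Jaynes1965, Csiszar1975, Ruelle1969, GoldsteinLebowitz2004
[support] (the squeeze proper) NoMeanEntropyProduction → MeanBlocksInRange → HardSphereLDA →
HsEosLowDensity → DiluteSelfConsistency → BlockGibbs. Plan: (i) exact finite-N bookkeeping
klDiv(lawAt s ‖ ψ_λ)/(N+1) = [(N+1)⁻¹ log Z_N(λ) − ⟨μ¹_(N,s), φ_λ⟩] − [(N+1)⁻¹ log Z_N(λ₀) −
⟨μ¹_(N,0), φ_λ₀⟩] for every block-constant local Gibbs ψ_λ (Liouville invariance of ∫f log f; log
ψ_λ is a one-body sum pairing with block mass / momentum / energy of the intensity measure); (ii) λ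
conjugate to the block mean fields (compact by MeanBlocksInRange, dilute by DiluteSelfConsistency),
uniform LDA from HardSphereLDA (B) + 1-Lipschitz dependence of log Z on log a, Fenchel ⇒ Π(λ) −
⟨V_s,λ⟩ = 𝒮^m_N(s); (iii) at t = 0 HardSphereLDA (A)+(B) + the tree's localGibbs_lln identify U₀ and
give −𝒮[U₀]; (iv) K1 + classical entropy conservation ⇒ klDiv ≤ (δ + o(1))(N+1). [difficulty: M] -/
@[route_item "route-AtomisticToContinuum-JaynesSqueeze", crux]
def SqueezeToBlockGibbs : Prop :=
  NoMeanEntropyProduction → MeanBlocksInRange → HardSphereLDA → HsEosLowDensity → DiluteSelfConsistency → BlockGibbs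

/-- item stmt-AtomisticToContinuum-13464 · support · rank 9 · open · by planner
sources: Yau1991, Dafermos1979, Csiszar1975, SaintRaymond2009, KipnisLandim1999
[support] (closure) BlockGibbs → CollisionalFluxLocality → EnergyCurrentTails → MeanBlocksInRange →
EntropicWeakStrongHS → HardSphereLDA → LocalGibbsConcentrationDilute → HsEosLowDensity →
DiluteSelfConsistency → RelEntropyVanishing. Plan: (a) kinetic closure from BlockGibbs:
conditionally on positions the reference has independent Maxwellian velocities, so entropy
inequality + conditional Hoeffding on truncated one-body observables + EnergyCurrentTails give the
mean kinetic fluxes as Maxwellian moments of the block mean fields + O(√δ) + o(1); (b)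
CollisionalFluxLocality adds the contact parts ⇒ the block mean fields V_N satisfy the weak form
against λ^E = Dh_σ(U) with residual → 0, ∫h_σ(V_N(s)) ≤ ∫h_σ(U₀) + o(1) (free Clausius direction),
V_N(0) → U₀; (c) EntropicWeakStrongHS ⇒ sup_(s≤t)‖V_N − U‖_(L²) → 0; (d) bookkeeping at the
Euler-driven reference a_t = ρ_t e^(g_σ(ρ_t)): klDiv/(N+1) = ⟨U(t) − P̄_t, λ^E_t⟩ + o(1) → 0;
LocalGibbsConcentrationDilute and isProbabilityMeasure_localGibbsLaw give the other clauses of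
RelEntropyVanishing. [difficulty: L] -/
@[route_item "route-AtomisticToContinuum-JaynesSqueeze"]
def BlockGibbsToRelEntropy : Prop :=
  BlockGibbs → CollisionalFluxLocality → EnergyCurrentTails → MeanBlocksInRange → EntropicWeakStrongHS → HardSphereLDA → LocalGibbsConcentrationDilute → HsEosLowDensity → DiluteSelfConsistency → RelEntropyVanishing

-- earlier Assembly (stmt-AtomisticToContinuum-13465, replaced 2026-08-16T16:57:07Z -> stmt-AtomisticToContinuum-15956): proved by Summit.AtomisticToContinuum.HydrodynamicLimit.Theorems.jaynesSqueeze_assembly_proof @ 14778427d7cb — NoMeanEntropyProduction → CollisionalFluxLocality → EnergyCurrentTails → MeanBlocksInRange → DiluteSelfConsistency → HsEosLowDensity → HardSphereLDA → LocalGibbsConcentrat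
/-- item stmt-AtomisticToContinuum-15956 · assembly · rank 1 · open · by planner
sources: Yau1991, Dafermos1979, Csiszar1975, Spohn1991
[assembly] X → HydrodynamicLimit for the thesis X = K1 ∧ K2 ∧ K4 ∧ R ∧ D: NoMeanEntropyProduction →
CollisionalFluxLocality → EnergyCurrentTails → MeanBlocksInRange → DiluteSelfConsistency →
HydrodynamicLimit — the five ranked cruxes alone imply the conjunct. Not pure logic (restated
2026-08-16 by route-repair after the ground battery closed the earlier 12-hypothesis form, the
literal type of `closes` and proved as stmt-13465, by `intros; aesop`): it packages the support
spine and is `fun h₁ h₂ h₃ h₄ h₅ => closes h₁ h₂ h₃ h₄ h₅ h₆ h₇ h₈ h₉ hS hB hE` once the seven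
support items are proved — HsEosLowDensity, HardSphereLDA, EntropyToHydro already are;
LocalGibbsConcentrationDilute, EntropicWeakStrongHS, SqueezeToBlockGibbs, BlockGibbsToRelEntropy are
the remaining debts (land those first; a direct proof bypassing them is equally welcome). `closes`
stays the deciding theorem. [deps: SqueezeToBlockGibbs, BlockGibbsToRelEntropy,
LocalGibbsConcentrationDilute, EntropicWeakStrongHS] [difficulty: L] -/
@[route_item "route-AtomisticToContinuum-JaynesSqueeze"]
def Assembly : Prop :=
  NoMeanEntropyProduction → CollisionalFluxLocality → EnergyCurrentTails → MeanBlocksInRange → DiluteSelfConsistency → _root_.HydrodynamicLimit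

-- records of items no longer active in this route (dropped / restated):
-- earlier EntropyToHydro (stmt-AtomisticToContinuum-0769, dropped 2026-08-16T17:21:42Z): proved by Summit.AtomisticToContinuum.HydrodynamicLimit.Theorems.heatBathForgetting_assembly_proof @ 7068fd10e358 — RelEntropyVanishing → Literature.MathematicalPhysics.KineticTheory.HydrodynamicLimit

/-! D-0027 §2.1 — DECIDING THEOREM (planner-authored via `route open/edit --closes-file`; by planner-rrepair-AtomisticToContinuum-JaynesSqu-51f6308f-0 2026-08-16T23:12:20Z):
its hypotheses are this route's items and its conclusion the sub-problem Statement (glue_lint), and it elaborates with this file. -/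

@[closes "route-AtomisticToContinuum-JaynesSqueeze"] theorem closes (h₁ : NoMeanEntropyProduction) (h₂ : CollisionalFluxLocality) (h₃ : EnergyCurrentTails)
    (h₄ : MeanBlocksInRange) (h₅ : DiluteSelfConsistency) (h₆ : SqueezeClosure) : _root_.HydrodynamicLimit :=
  _root_.HydrodynamicLimit.of_unguarded
    (_root_.Summit.AtomisticToContinuum.HydrodynamicLimit.Theorems.heatBathForgetting_assembly_proof
      (h₆ h₁ h₂ h₃ h₄ h₅))

end Summit.AtomisticToContinuum.HydrodynamicLimit.Theses.JaynesSqueeze
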